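import Literature.NumberTheory.LFunctions.HeilbronnPhenomenonElementaryConsequences
import Literature.NumberTheory.LFunctions.ZetaClassicalRegionBounds
import Mathlib.Analysis.SpecialFunctions.Pow.Asymptotics
import HarnessLib

/-!
# The Heilbronn phenomenon in the range `γ < 1/4` by Pintz's elementary method — Bellotti–Puglisi
# 2023, Theorems 2–3 and Corollary 3, PROVED in a REPAIRED exponent window (`b > 4/(1−4γ)`)

Topic `Literature/NumberTheory/LFunctions` (namespace `Literature.NumberTheory.LFunctions`, helpers in
the grouping sub-namespace `BellottiPuglisi2023`). PROOF LAYER companion of the statement file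
`ElementaryDeuringHeilbronnPhenomenon.lean` (cell `parity-realchar`, SIEGEL INSTRUMENT, conditionals
column I.8 «Deuring–Heilbronn repulsion»). Source: C. Bellotti, G. Puglisi, *Elementary methods in the
study of the Deuring–Heilbronn phenomenon*, Acta Arith. **208** (2023) 257–277 = arXiv:2201.03990v3
[BellottiPuglisi2023], §1 Theorem 2 / Theorem 3 / Corollary 3 (pp. 4–5), proofs §3 pp. 11–16 and §4
p. 16 — READ (held text `paper:arxiv-2201.03990` and the arXiv LaTeX source, 2026-08-29). Everything
in this file is PROVED (theorems only, no definition, no named fact); axioms `propext`,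
`Classical.choice`, `Quot.sound`.

## What the source prints, and why the window is repaired here

PRINT (Theorem 2, p. 4; LaTeX l. 184): "`L(1, χ_D) ≥ c₁/(U^{bγ} log³U)` for
`\frac{1}{2(1-3\gamma)} < b < \frac{1}{2\gamma}` … where `U = k|s₀|D` and `c₁` is an effective
constant" (`s₀ = 1 − γ + it` a zero of `L(s, χ_k)`, `0 < γ < 1/4` for real `χ_k`, `0 < γ ≤ 1/8` for
complex `χ_k`; `χ_D` real non-principal with `χ_kχ_D` non-principal); Theorem 3 (p. 4): the same
window, `δ > c₁/(U^{bγ} log⁵U)` for a real exceptional zero `1 − δ` of `L(s, χ_D)`; Corollary 3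
(p. 5): for `0 < γ ≤ 1/8` at most one primitive real `χ_D` vanishes in
`[1 − min(γ, c₁/(32 log⁵D · D^{bγ})), 1]`.

TWO DEFECTS are recorded (the named facts `bellottiPuglisi2023_theorem2/_theorem3/_corollary3` of the
statement file are kept as typed and flagged there):
1. The statement file typed the window as `(1 − 3γ)/2 < b`, a mis-reading of the printed
   `1/(2(1 − 3γ)) < b` (`≥ 1/2 > (1−3γ)/2`): the typed facts are STRONGER than print.
2. The printed proof does not deliver the printed window with `c₁ = c₁(γ, b)`: (a) its (9) and the
   sentence "for `U ≥ U₀(γ)` … `2|s₀|√k · U^{b(γ−1/2+1/2h)+1/4} · log³U ≤ 3/10`" (p. 14) treat the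
   factor `2|s₀|√k` as bounded, which it is not uniformly (`|s₀|√k ≍ U` when `k`, `D` are bounded and
   `|t| → ∞`); (b) its (10) absorbs the error term `O(U^{−(b/2h−1/4)})` of Pintz's Lemma 1 (part II)
   into `c₀U^{bγ}log³U · L(1, χ_D)`, which presupposes a lower bound for `L(1, χ_D)`; (c) its
   (11)–(15) derive the window from the compatibility condition `γ < 1/3 − 1/(3h)` alone, dropping
   condition (8) `b > 1/(4(1/2 − γ − 1/2h))`, which with `h < 2b` already forces `b > 1/(1 − 2γ)`;
   (d) Corollary 3 prints `D^{bγ}` where `U = k|s₀|D ≤ D²` gives `D^{2bγ}` (as in Pintz IV Theorem 3,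
   `D^{12ε} = D^{2·6ε}`).
   The printed statements are neither refuted (their hypothesis, an `L`-zero with real part `≥ 3/4`,
   is not known to occur) nor supported by a proof.

WHAT IS PROVED HERE is what the printed method gives when carried out uniformly — Pintz's 1976 (IV)
argument with the trivial character-sum bounds `|Σχ| ≤ q` and the cut at `U^{b/2}` (the paper's
`h = 2`): for `0 < γ < 1/4` and **`b > 4/(1 − 4γ)`** (i.e. `b(1/4 − γ) > 1`) there is
`c₁ = c₁(γ, b) > 0` with `L(1, χ_D) ≥ c₁/(U^{bγ} log³U)` for ALL `U` (Theorem 2′,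
`bellottiPuglisi2023_theorem2_largeB` — the body of the named fact verbatim, window replaced), hence
`δ > c₁/(U^{bγ} log⁵U)` (Theorem 3′, `bellottiPuglisi2023_theorem3_largeB`) and, for `0 < γ ≤ 1/8`
and `b > 8/(1 − 4γ)`, the "at most one primitive real character" statement with the printed window
`c₁/(32 log⁵D·D^{bγ})` (Corollary 3′, `bellottiPuglisi2023_corollary3_largeB`, via Theorem 3′ at
`b/2`). This realises the paper's headline extension of Pintz's range `γ < 0.05` to `γ < 1/4` (real
`χ_k`) / `γ ≤ 1/8` (complex `χ_k`) with an explicit exponent `bγ`, `b = 4/(1−4γ) + 0`.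

## Road (printed §3, in the same order; tree engines named)

* (4) = Pintz's (3.10)–(3.12): the identity `1_□ = g_D ∗ f` and the swap — the tree's
  `Pintz1976Heilbronn.sum_sqInd_eq_sum_sq`, `sum_sqInd_eq_sum_weight_mul_innerSum`,
  `norm_weight_term_le` (Parts A–B of `HeilbronnPhenomenonElementaryProofs.lean`, reused verbatim).
* (5) (real `χ_k`): `|Σ_{l ≤ N₁, (l,k)=1} l^{−2s₀}| ≥ ‖L(2s₀, 𝟙_k)‖ − 2/√N₁ ≥ 1/3 − 1/6` — HERE by the
  Möbius inversion `L(w, 𝟙_k)·L(w, 𝟙_kμ) = 1` (Mathlib `DirichletCharacter.LSeries.mul_mu_eq_one`) and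
  `‖L(w, 𝟙_kμ)‖ ≤ ζ(3/2) ≤ 3` (tree `ZetaClassicalRegion.norm_LSeries_le_of_norm_le_one`) in place of
  the printed Euler-product bound `ζ(4(1−γ))/ζ(2(1−γ)) > 0.36` (`norm_sum_sq_ge_real`).
* (6) (any `χ_k`, `γ ≤ 1/8`): `1 − Σ_{l=2}^{10} l^{−7/4} − ∫_{10}^∞ x^{−7/4}dx ≥ 0.028` (printed
  `0.029`; `norm_sum_sq_ge_of_ge_seven_eighths`, the nine terms checked by `c⁴l⁷ ≥ 1`).
* (7)–(9): the inner sums `S(M)` by the tree's Part D `Pintz1976Heilbronn.norm_innerSum_le`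
  (`‖S(M)‖ ≤ 4kD(1+|s|/σ)(2+log M)M^{1/2−σ}`, trivial bounds — the Pólya–Vinogradov refinement of
  (7) gives no uniform gain because of the factor `|s₀|`), and `Σ₁` by the tree's `sigma_one_le`.
* (10): `Σ₂` by the tree's `sigma_two_le` and `sum_card_divisors_div_le`; the block
  `Σ_{N₁<c≤N₁²} g_D(c)/c ≤ log N₁·L(1,χ_D) + 24(D+1)(log N₁+1)/√N₁` from the tree's Montgomery–Vaughan
  Exercise 11.2.3(g) `DirichletAbel.norm_sum_divisorSum_div_sub_le` at a GENERAL cut `N₁`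
  (`sum_charDivisorSum_div_le_gen`; Pintz/BP cite Lemma 1 of part II).
* Assembly (`upper_chain`, `large_case`, `endgame_gen`): with `N₁ = ⌊U^{b/2}⌋`,
  `0.028 ≤ 48(b+2)³log³U·U^{1+bγ−b/4} + 36(b+2)³log³U·U^{1+bγ−b/4} + (b+2)³log³U·U^{bγ'}·L(1,χ_D)`,
  and `1 + bγ − b/4 < 0` is exactly `b > 4/(1−4γ)`; thresholds by `log³x = o(x^ε)`
  (`eventually_thresholds_gen`); below the threshold `D ≤ U` is bounded and `L(1, χ_D) > 0` has a
  positive minimum over the finitely many quadratic characters (`exists_pos_le_LFunction_one`, Mathlib's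
  finiteness of `DirichletCharacter ℂ D`) — so `c₁ = min(0.014/(b+2)³, m)` serves all `U`.
* §4 (Theorem 3): Page's step `L(1, χ_D)/δ ≤ log²D` in the tree's form
  `Pintz1976Heilbronn.norm_LFunction_one_le_of_realZero` (`‖L(1,χ_D)‖ ≤ 0.7δ log²D`, `log D ≥ 100`);
  for `log D < 100` the real zeros stay outside `[1 − r₀, 1]` uniformly (`exists_zeroFree_near_one`,
  continuity at `1`).
* Corollary 3: the character with the smaller modulus supplies the auxiliary zero (`t = 0`,
  `U = D₁σ₁D₂ ≤ D₂²`, `U^{(b/2)γ'} ≤ D₂^{bγ}`, `log⁵U ≤ 32 log⁵D₂`); distinct primitive real characters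
  have a non-principal product (tree `Pintz1976Heilbronn.productNonprincipal_of_not_same`).

The cores `BellottiPuglisi2023.theorem2_core` / `theorem3_core` are UNIFORM in the depth `γ' ≤ γ` of
the auxiliary zero (needed for Corollary 3, where the zero of the first character has depth `≤ γ`).

LABEL (cell rule): instrument / proof layer. WHAT THIS IS NOT: no claim that any `L(s, χ_k)` has a
zero off the critical line; the thresholds inside `c₁` are effective but not numerically evaluated;
nothing here bears on parity. No instances, no notation, no axioms beyond the standard three.

## References

* [BellottiPuglisi2023] C. Bellotti, G. Puglisi, Acta Arith. 208 (2023) 257–277 = arXiv:2201.03990v3: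
  Theorem 2, Theorem 3 (p. 4), Corollary 3 (p. 5); proofs §3 pp. 11–16 ((4)–(15)), §4 p. 16.
* [Pintz1976ElementaryIV] J. Pintz, Acta Arith. 31 (1976) 419–429, §3 (3.10)–(3.17) (the method;
  tree `HeilbronnPhenomenonElementaryProofs.lean`).
* [MontgomeryVaughan2007] H. L. Montgomery, R. C. Vaughan, *Multiplicative Number Theory I*, CUP 2007,
  §4.3 p. 102 (`L(1,χ) > 0`), §11.2.1 Exercise 3(g).
-/

noncomputable section

open Complex Finset ArithmeticFunction Filter Topology
open scoped ArithmeticFunction.Moebius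

namespace Literature.NumberTheory.LFunctions

namespace BellottiPuglisi2023

open Pintz1976Heilbronn DirichletAbel RealChar

/-! ### Part C′ — lower bounds for `|Σ_{l ≤ M} χ_k(l²) l^{-2s}|` in the range `σ > 3/4` -/

/-- Integral comparison: `Σ_{a < l ≤ M} l^{-u} ≤ a^{1-u}/(u − 1)` for `u > 1`, `a ≥ 1` (the step
`Σ_{l > 10} l^{-7/4} ≤ ∫_{10}^∞ dl/l^{7/4}` of (6), and the truncation in (5)).
[cite: BellottiPuglisi2023, §3 (6) p. 12] -/
theorem sum_Icc_succ_rpow_neg_le {u : ℝ} (hu : 1 < u) {a : ℕ} (ha : 1 ≤ a) (M : ℕ) :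
    ∑ l ∈ Icc (a + 1) M, (l : ℝ) ^ (-u) ≤ (a : ℝ) ^ (1 - u) / (u - 1) := by
  have ha0 : (0 : ℝ) < a := by exact_mod_cast ha
  have hu1 : 0 < u - 1 := by linarith
  rcases lt_or_ge M (a + 1) with hM | hM
  · rw [Finset.Icc_eq_empty (by omega), sum_empty]; positivity
  have hanti : AntitoneOn (fun x : ℝ => x ^ (-u)) (Set.Icc (a : ℝ) M) := by
    refine (Real.antitoneOn_rpow_Ioi_of_exponent_nonpos (by linarith)).mono ?_
    intro x hx
    exact lt_of_lt_of_le ha0 hx.1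
  have hcmp := AntitoneOn.sum_le_integral_Ico (by omega : a ≤ M) hanti
  have hIco : ∑ i ∈ Finset.Ico a M, ((i + 1 : ℕ) : ℝ) ^ (-u) =
      ∑ l ∈ Icc (a + 1) M, (l : ℝ) ^ (-u) := by
    rw [← Finset.Ico_add_one_right_eq_Icc, Finset.sum_Ico_eq_sum_range,
      Finset.sum_Ico_eq_sum_range, show M + 1 - (a + 1) = M - a by omega]
    refine sum_congr rfl fun j _ => ?_
    push_cast; ring_nf
  rw [hIco] at hcmp
  refine hcmp.trans ?_
  have h0 : (0 : ℝ) ∉ Set.uIcc (a : ℝ) (M : ℝ) := by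
    intro h0
    rcases Set.mem_uIcc.mp h0 with ⟨h1, _⟩ | ⟨h1, _⟩
    · linarith
    · have : (a : ℝ) ≤ M := by exact_mod_cast (show a ≤ M by omega)
      linarith
  rw [integral_rpow (Or.inr ⟨by linarith, h0⟩)]
  have e : -u + 1 = -(u - 1) := by ring
  rw [e, div_neg, ← neg_div, neg_sub]
  have hM0 : (0 : ℝ) ≤ (M : ℝ) ^ (-(u - 1)) := by positivity
  have e2 : (a : ℝ) ^ (-(u - 1)) = (a : ℝ) ^ (1 - u) := by congr 1; ring
  rw [e2] at *
  exact div_le_div_of_nonneg_right (by linarith) hu1.le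

/-- `Σ_{a < l ≤ M} l^{-u} ≤ 2/√a` for `u ≥ 3/2`, `a ≥ 1` (truncation of the series in (5)).
[cite: BellottiPuglisi2023, §3 (5) p. 12] -/
theorem sum_Icc_succ_rpow_neg_le_two_div_sqrt {u : ℝ} (hu : 3 / 2 ≤ u) {a : ℕ} (ha : 1 ≤ a)
    (M : ℕ) : ∑ l ∈ Icc (a + 1) M, (l : ℝ) ^ (-u) ≤ 2 / Real.sqrt a := by
  have ha1 : (1 : ℝ) ≤ a := by exact_mod_cast ha
  have ha0 : (0 : ℝ) < a := by linarith
  refine (sum_Icc_succ_rpow_neg_le (by linarith) ha M).trans ?_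
  have h1 : (a : ℝ) ^ (1 - u) ≤ (a : ℝ) ^ (-(1 / 2 : ℝ)) :=
    Real.rpow_le_rpow_of_exponent_le ha1 (by linarith)
  have h2 : (a : ℝ) ^ (-(1 / 2 : ℝ)) = 1 / Real.sqrt a := by
    rw [Real.rpow_neg ha0.le, Real.sqrt_eq_rpow, inv_eq_one_div]
  have hs0 : 0 < Real.sqrt a := Real.sqrt_pos.mpr ha0
  have h3 : (a : ℝ) ^ (1 - u) / (u - 1) ≤ (1 / Real.sqrt a) / (1 / 2) := by
    rw [← h2]
    exact div_le_div₀ (by positivity) h1 (by norm_num) (by linarith)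
  refine h3.trans (le_of_eq ?_)
  field_simp

variable {k : ℕ} (χk : DirichletCharacter ℂ k)

/-- The partial sums `Σ_{l ≤ M} f(l) l^{-w}` are the `range (M+1)` partial sums of the `L`-series
terms. [folklore] -/
private theorem sum_range_succ_term_eq (f : ℕ → ℂ) (w : ℂ) (M : ℕ) :
    ∑ i ∈ range (M + 1), LSeries.term f w i = ∑ l ∈ Ioc 0 M, f l * (l : ℂ) ^ (-w) := by
  induction M with
  | zero => simp [LSeries.term_zero]
  | succ M ih =>
    rw [sum_range_succ, ih, Finset.sum_Ioc_succ_top (Nat.zero_le M),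
      LSeries.term_of_ne_zero (Nat.succ_ne_zero M), cpow_neg, div_eq_mul_inv]

/-- **Tail of an absolutely convergent `L`-series**: for `‖f‖ ≤ 1` and `u = Re w ≥ 3/2`,
`‖L(f, w) − Σ_{l ≤ N} f(l) l^{-w}‖ ≤ 2/√N` (`N ≥ 1`) — the passage from the finite sum over `n ≤ U^b`
to the full series in (5). [cite: BellottiPuglisi2023, §3 (5) p. 12] -/
theorem norm_LSeries_sub_sum_le {f : ℕ → ℂ} (hf : ∀ n, ‖f n‖ ≤ 1) {w : ℂ} (hw : 3 / 2 ≤ w.re)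
    {N : ℕ} (hN : 1 ≤ N) :
    ‖LSeries f w - ∑ l ∈ Ioc 0 N, f l * (l : ℂ) ^ (-w)‖ ≤ 2 / Real.sqrt N := by
  have hw1 : 1 < w.re := by linarith
  have hsum : LSeriesSummable f w :=
    LSeriesSummable_of_bounded_of_one_lt_re (m := 1) (fun n _ => hf n) hw1
  -- partial sums converge
  have ht : Tendsto (fun M : ℕ => ∑ l ∈ Ioc 0 M, f l * (l : ℂ) ^ (-w)) atTop
      (𝓝 (LSeries f w)) := by
    have h := (hsum.LSeriesHasSum).tendsto_sum_nat.comp (tendsto_add_atTop_nat 1)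
    refine h.congr fun M => ?_
    simp only [Function.comp]
    exact sum_range_succ_term_eq f w M
  -- finite differences are bounded by the tail sum
  have hdiff : ∀ M : ℕ, N ≤ M →
      ‖∑ l ∈ Ioc 0 M, f l * (l : ℂ) ^ (-w) - ∑ l ∈ Ioc 0 N, f l * (l : ℂ) ^ (-w)‖ ≤
        2 / Real.sqrt N := by
    intro M hNM
    rw [← sum_Ioc_consecutive _ (Nat.zero_le N) hNM, add_sub_cancel_left]
    refine (norm_sum_le _ _).trans ?_
    have hle : ∀ l ∈ Ioc N M, ‖f l * (l : ℂ) ^ (-w)‖ ≤ (l : ℝ) ^ (-w.re) := by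
      intro l hl
      have hl0 : 0 < l := by have := (mem_Ioc.mp hl).1; omega
      rw [norm_mul, norm_natCast_cpow_of_pos hl0, neg_re]
      calc ‖f l‖ * (l : ℝ) ^ (-w.re) ≤ 1 * (l : ℝ) ^ (-w.re) :=
            mul_le_mul_of_nonneg_right (hf l) (by positivity)
        _ = (l : ℝ) ^ (-w.re) := one_mul _
    refine (sum_le_sum hle).trans ?_
    rw [← Finset.Icc_add_one_left_eq_Ioc]
    exact sum_Icc_succ_rpow_neg_le_two_div_sqrt hw hN M
  -- pass to the limit
  have hlim : Tendsto (fun M : ℕ => ‖∑ l ∈ Ioc 0 M, f l * (l : ℂ) ^ (-w) -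
      ∑ l ∈ Ioc 0 N, f l * (l : ℂ) ^ (-w)‖) atTop
      (𝓝 ‖LSeries f w - ∑ l ∈ Ioc 0 N, f l * (l : ℂ) ^ (-w)‖) :=
    (continuous_norm.tendsto _).comp (ht.sub_const _)
  exact le_of_tendsto hlim (Filter.eventually_atTop.mpr ⟨N, hdiff⟩)

open scoped LSeries.notation in
/-- **Möbius lower bound**: for the principal character `𝟙_k` and `Re w ≥ 3/2`,
`‖L(w, 𝟙_k)‖ ≥ 1/3`, because `L(w, 𝟙_k) · L(w, 𝟙_k μ) = 1` (Mathlib) and `‖L(w, 𝟙_k μ)‖ ≤ ζ(3/2) ≤ 3`.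
[cite: BellottiPuglisi2023, §3 (5) p. 12 (Euler product lower bound)] -/
theorem norm_LSeries_one_ge [NeZero k] {w : ℂ} (hw : 3 / 2 ≤ w.re) :
    1 / 3 ≤ ‖L ↗(1 : DirichletCharacter ℂ k) w‖ := by
  have hw1 : 1 < w.re := by linarith
  have hmu := DirichletCharacter.LSeries.mul_mu_eq_one (1 : DirichletCharacter ℂ k) hw1
  have hbound : ‖L (↗(1 : DirichletCharacter ℂ k) * ↗(μ : ArithmeticFunction ℤ)) w‖ ≤ 3 := by
    have h1 : ∀ n, ‖(↗(1 : DirichletCharacter ℂ k) * ↗(μ : ArithmeticFunction ℤ)) n‖ ≤ 1 := by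
      intro n
      simp only [Pi.mul_apply, norm_mul]
      have ha : ‖((1 : DirichletCharacter ℂ k) (n : ZMod k) : ℂ)‖ ≤ 1 :=
        DirichletCharacter.norm_le_one _ _
      have hb : ‖((μ n : ℤ) : ℂ)‖ ≤ 1 := by
        rw [Complex.norm_intCast]
        exact_mod_cast ArithmeticFunction.abs_moebius_le_one
      exact mul_le_one₀ ha (norm_nonneg _) hb
    refine (ZetaClassicalRegion.norm_LSeries_le_of_norm_le_one h1 hw1).trans ?_
    rw [div_le_iff₀ (by linarith)]
    linarith
  have hnorm : ‖L ↗(1 : DirichletCharacter ℂ k) w‖ *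
      ‖L (↗(1 : DirichletCharacter ℂ k) * ↗(μ : ArithmeticFunction ℤ)) w‖ = 1 := by
    rw [← norm_mul, hmu, norm_one]
  have hpos : 0 < ‖L ↗(1 : DirichletCharacter ℂ k) w‖ := by
    by_contra hle
    push Not at hle
    have : ‖L ↗(1 : DirichletCharacter ℂ k) w‖ = 0 := le_antisymm hle (norm_nonneg _)
    rw [this, zero_mul] at hnorm
    exact zero_ne_one hnorm
  rw [div_le_iff₀ (by norm_num : (0 : ℝ) < 3)]
  nlinarith [norm_nonneg (L (↗(1 : DirichletCharacter ℂ k) * ↗(μ : ArithmeticFunction ℤ)) w)]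

/-- For a quadratic `χ_k`, `χ_k(l²) = 𝟙_k(l)`. [cite: BellottiPuglisi2023, §3 (5) p. 12] -/
theorem apply_sq_eq_one_apply (hq : χk ^ 2 = 1) (l : ℕ) :
    χk ((l ^ 2 : ℕ) : ZMod k) = (1 : DirichletCharacter ℂ k) (l : ZMod k) := by
  rw [Nat.cast_pow, map_pow, ← MulChar.pow_apply' χk two_ne_zero, hq]

open scoped LSeries.notation in
/-- **Part C′, real case**: for quadratic `χ_k`, `Re s ≥ 3/4` and `M ≥ 144`,
`‖Σ_{l ≤ M} χ_k(l²) (l²)^{-s}‖ ≥ 1/6` (`= |Σ_{l ≤ M, (l,k)=1} l^{-2s}| ≥ ‖L(2s, 𝟙_k)‖ − 2/√M ≥ 1/3 − 1/6`).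
[cite: BellottiPuglisi2023, §3 (5) p. 12] -/
theorem norm_sum_sq_ge_real [NeZero k] (hq : χk ^ 2 = 1) {s : ℂ} (hσ : 3 / 4 ≤ s.re) {M : ℕ}
    (hM : 144 ≤ M) :
    1 / 6 ≤ ‖∑ l ∈ Ioc 0 M, χk ((l ^ 2 : ℕ) : ZMod k) * ((l ^ 2 : ℕ) : ℂ) ^ (-s)‖ := by
  set w : ℂ := 2 * s with hwdef
  have hw : 3 / 2 ≤ w.re := by simp [hwdef]; linarith
  set f : ℕ → ℂ := ↗(1 : DirichletCharacter ℂ k) with hfdef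
  have hf : ∀ n, ‖f n‖ ≤ 1 := fun n => DirichletCharacter.norm_le_one _ _
  have hid : ∑ l ∈ Ioc 0 M, χk ((l ^ 2 : ℕ) : ZMod k) * ((l ^ 2 : ℕ) : ℂ) ^ (-s) =
      ∑ l ∈ Ioc 0 M, f l * (l : ℂ) ^ (-w) := by
    refine sum_congr rfl fun l hl => ?_
    rw [apply_sq_eq_one_apply χk hq l, hfdef]
    congr 1
    rw [Nat.cast_pow, hwdef, show -(2 * s) = ((2 : ℕ) : ℂ) * (-s) by push_cast; ring,
      Complex.natCast_cpow_natCast_mul]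
  rw [hid]
  have htail := norm_LSeries_sub_sum_le hf hw (N := M) (by omega)
  have hL := norm_LSeries_one_ge (k := k) hw
  have hsqrt : (12 : ℝ) ≤ Real.sqrt M := by
    rw [show (12 : ℝ) = Real.sqrt 144 by rw [show (144 : ℝ) = 12 ^ 2 by norm_num,
      Real.sqrt_sq (by norm_num)]]
    exact Real.sqrt_le_sqrt (by exact_mod_cast hM)
  have htail' : 2 / Real.sqrt M ≤ 1 / 6 := by
    rw [div_le_div_iff₀ (by linarith) (by norm_num)]; linarith
  have h := norm_sub_norm_le (L f w) (L f w - ∑ l ∈ Ioc 0 M, f l * (l : ℂ) ^ (-w))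
  rw [sub_sub_cancel] at h
  linarith

/-- `l^{-7/4} ≤ c` from `1 ≤ c⁴ l⁷` (`c > 0`, `l ≥ 1`). [folklore] -/
private theorem rpow_neg_seven_quarters_le {l : ℕ} (hl : 1 ≤ l) {c : ℝ} (hc : 0 < c)
    (h : 1 ≤ c ^ 4 * (l : ℝ) ^ 7) : (l : ℝ) ^ (-(7 / 4 : ℝ)) ≤ c := by
  have hl0 : (0 : ℝ) < l := by exact_mod_cast hl
  have hx0 : 0 ≤ (l : ℝ) ^ (-(7 / 4 : ℝ)) := by positivity
  have hx4 : ((l : ℝ) ^ (-(7 / 4 : ℝ))) ^ 4 = ((l : ℝ) ^ 7)⁻¹ := by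
    rw [← Real.rpow_mul_natCast hl0.le, show (-(7 / 4 : ℝ)) * ((4 : ℕ) : ℝ) = -((7 : ℕ) : ℝ) by
      norm_num, Real.rpow_neg hl0.le, Real.rpow_natCast]
  have hle4 : ((l : ℝ) ^ (-(7 / 4 : ℝ))) ^ 4 ≤ c ^ 4 := by
    rw [hx4, inv_le_iff_one_le_mul₀ (by positivity)]
    linarith [h]
  exact le_of_pow_le_pow_left₀ (by norm_num) hc.le hle4

/-- **`Σ_{2 ≤ l ≤ M} l^{-2σ} ≤ 0.972`** for `σ ≥ 7/8` (the terms `l = 2,…,10` numerically, the rest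
by `∫_{10}^∞ x^{-7/4} dx = (4/3)·10^{-3/4}`). [cite: BellottiPuglisi2023, §3 (6) p. 12] -/
theorem sum_Icc_two_rpow_le_of_ge_seven_eighths {σ : ℝ} (hσ : 7 / 8 ≤ σ) (M : ℕ) :
    ∑ l ∈ Icc 2 M, (l : ℝ) ^ (-(2 * σ)) ≤ 0.972 := by
  -- compare with the exponent `-7/4`
  have hmono : ∀ l ∈ Icc 2 M, (l : ℝ) ^ (-(2 * σ)) ≤ (l : ℝ) ^ (-(7 / 4 : ℝ)) := by
    intro l hl
    have hl1 : (1 : ℝ) ≤ l := by exact_mod_cast (show 1 ≤ l by have := (mem_Icc.mp hl).1; omega)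
    exact Real.rpow_le_rpow_of_exponent_le hl1 (by linarith)
  refine (sum_le_sum hmono).trans ?_
  have hsub : Icc 2 M ⊆ Icc 2 10 ∪ Icc 11 M := by
    intro l hl
    simp only [mem_union, mem_Icc] at hl ⊢
    omega
  refine (sum_le_sum_of_subset_of_nonneg hsub fun l _ _ => by positivity).trans ?_
  have hdisj : Disjoint (Icc 2 10) (Icc 11 M) := by
    rw [Finset.disjoint_left]
    intro l h1 h2
    simp only [mem_Icc] at h1 h2
    omega
  rw [sum_union hdisj]
  -- the nine explicit terms
  have h2 := rpow_neg_seven_quarters_le (l := 2) (by norm_num) (c := 0.2974) (by norm_num) (by norm_num)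
  have h3 := rpow_neg_seven_quarters_le (l := 3) (by norm_num) (c := 0.1463) (by norm_num) (by norm_num)
  have h4 := rpow_neg_seven_quarters_le (l := 4) (by norm_num) (c := 0.0884) (by norm_num) (by norm_num)
  have h5 := rpow_neg_seven_quarters_le (l := 5) (by norm_num) (c := 0.0599) (by norm_num) (by norm_num)
  have h6 := rpow_neg_seven_quarters_le (l := 6) (by norm_num) (c := 0.0435) (by norm_num) (by norm_num)
  have h7 := rpow_neg_seven_quarters_le (l := 7) (by norm_num) (c := 0.0332) (by norm_num) (by norm_num)
  have h8 := rpow_neg_seven_quarters_le (l := 8) (by norm_num) (c := 0.0263) (by norm_num) (by norm_num)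
  have h9 := rpow_neg_seven_quarters_le (l := 9) (by norm_num) (c := 0.0214) (by norm_num) (by norm_num)
  have h10 := rpow_neg_seven_quarters_le (l := 10) (by norm_num) (c := 0.0178) (by norm_num) (by norm_num)
  have hset : Icc (2 : ℕ) 10 = {2, 3, 4, 5, 6, 7, 8, 9, 10} := by decide
  have hfirst : ∑ l ∈ Icc (2 : ℕ) 10, ((l : ℕ) : ℝ) ^ (-(7 / 4 : ℝ)) ≤ 0.7342 := by
    rw [hset, sum_insert (by decide), sum_insert (by decide), sum_insert (by decide),
      sum_insert (by decide), sum_insert (by decide), sum_insert (by decide),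
      sum_insert (by decide), sum_insert (by decide), sum_singleton]
    push_cast at h2 h3 h4 h5 h6 h7 h8 h9 h10 ⊢
    have hnum : (0.2974 : ℝ) + 0.1463 + 0.0884 + 0.0599 + 0.0435 + 0.0332 + 0.0263 + 0.0214 +
        0.0178 ≤ 0.7342 := by norm_num
    linarith
  -- the tail from `11` on
  have htail : ∑ l ∈ Icc (11 : ℕ) M, ((l : ℕ) : ℝ) ^ (-(7 / 4 : ℝ)) ≤ 0.2372 := by
    have h := sum_Icc_succ_rpow_neg_le (u := 7 / 4) (by norm_num) (a := 10) (by norm_num) M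
    refine h.trans ?_
    have h10' : ((10 : ℕ) : ℝ) ^ (1 - 7 / 4 : ℝ) ≤ 0.1779 := by
      have e : (1 - 7 / 4 : ℝ) = -(3 / 4 : ℝ) := by norm_num
      rw [e]
      -- `10^{-3/4} ≤ 0.1779` since `0.1779⁴ · 10³ ≥ 1`
      have hx0 : 0 ≤ ((10 : ℕ) : ℝ) ^ (-(3 / 4 : ℝ)) := by positivity
      have hx4 : (((10 : ℕ) : ℝ) ^ (-(3 / 4 : ℝ))) ^ 4 = (((10 : ℕ) : ℝ) ^ 3)⁻¹ := by
        rw [← Real.rpow_mul_natCast (by positivity),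
          show (-(3 / 4 : ℝ)) * ((4 : ℕ) : ℝ) = -((3 : ℕ) : ℝ) by norm_num,
          Real.rpow_neg (by positivity), Real.rpow_natCast]
      have hle4 : (((10 : ℕ) : ℝ) ^ (-(3 / 4 : ℝ))) ^ 4 ≤ (0.1779 : ℝ) ^ 4 := by
        rw [hx4]; norm_num
      exact le_of_pow_le_pow_left₀ (by norm_num) (by norm_num) hle4
    have : ((10 : ℕ) : ℝ) ^ (1 - 7 / 4 : ℝ) / (7 / 4 - 1 : ℝ) ≤ 0.1779 / (7 / 4 - 1 : ℝ) :=
      div_le_div_of_nonneg_right h10' (by norm_num)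
    refine this.trans ?_
    norm_num
  have hnum : (0.7342 : ℝ) + 0.2372 ≤ 0.972 := by norm_num
  linarith

/-- **Part C′, general case**: for any character `χ_k`, `Re s ≥ 7/8` and `M ≥ 1`,
`‖Σ_{l ≤ M} χ_k(l²) (l²)^{-s}‖ ≥ 0.028` (the term `l = 1` is `1`, the rest is at most
`Σ_{l ≥ 2} l^{-7/4} ≤ 0.972`). [cite: BellottiPuglisi2023, §3 (6) p. 12] -/
theorem norm_sum_sq_ge_of_ge_seven_eighths {s : ℂ} (hσ : 7 / 8 ≤ s.re) {M : ℕ} (hM : 1 ≤ M) :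
    0.028 ≤ ‖∑ l ∈ Ioc 0 M, χk ((l ^ 2 : ℕ) : ZMod k) * ((l ^ 2 : ℕ) : ℂ) ^ (-s)‖ := by
  have hsplit : ∑ l ∈ Ioc 0 M, χk ((l ^ 2 : ℕ) : ZMod k) * ((l ^ 2 : ℕ) : ℂ) ^ (-s) =
      1 + ∑ l ∈ Icc 2 M, χk ((l ^ 2 : ℕ) : ZMod k) * ((l ^ 2 : ℕ) : ℂ) ^ (-s) := by
    have e : Ioc 0 M = insert 1 (Icc 2 M) := by
      ext l; simp only [mem_Ioc, mem_insert, mem_Icc]; omega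
    rw [e, sum_insert (by simp)]
    simp
  rw [hsplit]
  have hrest : ‖∑ l ∈ Icc 2 M, χk ((l ^ 2 : ℕ) : ZMod k) * ((l ^ 2 : ℕ) : ℂ) ^ (-s)‖ ≤ 0.972 := by
    refine (norm_sum_le _ _).trans ((sum_le_sum fun l hl => ?_).trans
      (sum_Icc_two_rpow_le_of_ge_seven_eighths hσ M))
    have hl0 : 0 < l := by have := (mem_Icc.mp hl).1; omega
    rw [norm_mul, norm_natCast_cpow_of_pos (by positivity), neg_re]
    calc ‖χk ((l ^ 2 : ℕ) : ZMod k)‖ * ((l ^ 2 : ℕ) : ℝ) ^ (-s.re)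
        ≤ 1 * ((l ^ 2 : ℕ) : ℝ) ^ (-s.re) :=
          mul_le_mul_of_nonneg_right (χk.norm_le_one _) (by positivity)
      _ = (l : ℝ) ^ (-(2 * s.re)) := by
          rw [one_mul, Nat.cast_pow, ← Real.rpow_natCast, ← Real.rpow_mul (by positivity)]
          norm_num
  have h := norm_sub_norm_le (1 : ℂ)
    (-(∑ l ∈ Icc 2 M, χk ((l ^ 2 : ℕ) : ZMod k) * ((l ^ 2 : ℕ) : ℂ) ^ (-s)))
  rw [sub_neg_eq_add, norm_neg, norm_one] at h
  have e : (0.028 : ℝ) = 1 - 0.972 := by norm_num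
  rw [e]
  linarith


/-! ### Part F′ — `Σ_{N₁ < c ≤ N₁²} g_D(c)/c ≤ log N₁ · L(1, χ_D) + 24(D+1)(log N₁+1)/√N₁` -/

variable {q : ℕ} (χ : DirichletCharacter ℂ q)

/-- **The divisor-sum block at a general cut**: for quadratic `χ_D ≠ χ₀` mod `D` and `N₁ ≥ 4`,
`Σ_{N₁ < c ≤ N₁²} g_D(c)/c ≤ log N₁ · L(1, χ_D) + 24(D + 1)(log N₁ + 1)/√N₁` (the tree's
Montgomery–Vaughan Exercise 11.2.3(g) `DirichletAbel.norm_sum_divisorSum_div_sub_le` with the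
trivial bound `|Σχ_D| ≤ D`, at `N = N₁²` with `Y = N₁` and at `N₁` with `Y = ⌊√N₁⌋`, differenced).
[cite: BellottiPuglisi2023, §3 (10) p. 14 (Lemma 1 of [21])] -/
theorem sum_charDivisorSum_div_le_gen [NeZero q] (hq : χ ^ 2 = 1) (hχ : χ ≠ 1) {N₁ : ℕ}
    (hN₁ : 4 ≤ N₁) :
    ∑ c ∈ Ioc N₁ (N₁ ^ 2), charDivisorSum χ c / (c : ℝ) ≤
      Real.log N₁ * (χ.LFunction 1).re +
        24 * ((q : ℝ) + 1) * (Real.log N₁ + 1) / Real.sqrt N₁ := by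
  have hN₁0 : (0 : ℝ) < N₁ := by exact_mod_cast (show 0 < N₁ by omega)
  have hN₁1 : (1 : ℝ) ≤ N₁ := by exact_mod_cast (show 1 ≤ N₁ by omega)
  have hlog0 : 0 ≤ Real.log N₁ := Real.log_nonneg hN₁1
  have hq0 : (0 : ℝ) ≤ q := Nat.cast_nonneg q
  set N : ℕ := N₁ ^ 2 with hN
  have hN₁N : N₁ ≤ N := by rw [hN]; exact Nat.le_self_pow (by norm_num) N₁
  have hNr : (N : ℝ) = (N₁ : ℝ) ^ 2 := by rw [hN]; push_cast; ring
  have hlogN : Real.log (N : ℝ) = 2 * Real.log N₁ := by rw [hNr, Real.log_pow]; push_cast; ring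
  -- the square root
  set r : ℝ := Real.sqrt N₁ with hr
  have hr0 : 0 < r := Real.sqrt_pos.mpr hN₁0
  have hr1 : 1 ≤ r := by rw [hr, show (1 : ℝ) = Real.sqrt 1 by simp]; exact Real.sqrt_le_sqrt hN₁1
  have hrsq : r ^ 2 = N₁ := by rw [hr, Real.sq_sqrt hN₁0.le]
  have hrN₁ : r ≤ N₁ := by nlinarith
  set y : ℕ := Nat.sqrt N₁ with hy
  have hy2 : 2 ≤ y := by
    rw [hy, Nat.le_sqrt]; omega
  have hyN₁ : y ≤ N₁ := Nat.sqrt_le_self N₁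
  have hyr : (y : ℝ) ≤ r := by
    rw [hr, Real.le_sqrt (Nat.cast_nonneg y) hN₁0.le]
    exact_mod_cast Nat.sqrt_le' N₁
  have hry : r ≤ (y : ℝ) + 1 := by
    have h1 : (N₁ : ℝ) < ((y : ℝ) + 1) ^ 2 := by exact_mod_cast Nat.lt_succ_sqrt' N₁
    nlinarith
  -- the two applications of Exercise 11.2.3(g)
  have hB := norm_partialSum_le χ hχ
  have e1 := norm_sum_divisorSum_div_sub_le χ hχ hB (by omega : 2 ≤ N₁) hN₁N
  have e2 := norm_sum_divisorSum_div_sub_le χ hχ hB hy2 hyN₁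
  set Lχ : ℂ := χ.LFunction 1
  set Lχ' : ℂ := deriv χ.LFunction 1
  set mN : ℂ := (((Real.log N + Real.eulerMascheroniConstant : ℝ)) : ℂ) * Lχ + Lχ'
  set mN₁ : ℂ := (((Real.log N₁ + Real.eulerMascheroniConstant : ℝ)) : ℂ) * Lχ + Lχ'
  have hmain : mN - mN₁ = ((Real.log N₁ : ℝ) : ℂ) * Lχ := by
    simp only [mN, mN₁, hlogN]
    push_cast
    ring
  have hG : ((∑ c ∈ Ioc N₁ N, charDivisorSum χ c / (c : ℝ) : ℝ) : ℂ) =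
      (divSumC χ N - mN) - (divSumC χ N₁ - mN₁) + ((Real.log N₁ : ℝ) : ℂ) * Lχ := by
    rw [ofReal_sum_Ioc_charDivisorSum_div χ hq hN₁N, ← hmain]; ring
  have hre : ∑ c ∈ Ioc N₁ N, charDivisorSum χ c / (c : ℝ) =
      ((divSumC χ N - mN) - (divSumC χ N₁ - mN₁)).re + Real.log N₁ * Lχ.re := by
    have := congrArg Complex.re hG
    rw [ofReal_re] at this
    rw [this, add_re, re_ofReal_mul]
  rw [hre]
  have hre_le : ((divSumC χ N - mN) - (divSumC χ N₁ - mN₁)).re ≤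
      ‖divSumC χ N - mN‖ + ‖divSumC χ N₁ - mN₁‖ :=
    (re_le_norm _).trans (norm_sub_le _ _)
  -- the first error term: `8D(2ℓ+1)/(N₁+1) + 4N₁/N₁² ≤ (16Dℓ + 8D + 4)/r`
  have hE1 : ‖divSumC χ N - mN‖ ≤ (16 * q * Real.log N₁ + 8 * q + 4) / r := by
    refine e1.trans ?_
    rw [hlogN, hNr]
    have h1 : 8 * (q : ℝ) * (2 * Real.log N₁ + 1) / ((N₁ : ℝ) + 1) ≤
        (16 * q * Real.log N₁ + 8 * q) / r := by
      rw [div_le_div_iff₀ (by positivity) hr0]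
      have : 0 ≤ 16 * (q : ℝ) * Real.log N₁ + 8 * q := by positivity
      nlinarith
    have h2 : 4 * (N₁ : ℝ) / (N₁ : ℝ) ^ 2 ≤ 4 / r := by
      rw [div_le_div_iff₀ (by positivity) hr0]; nlinarith
    have h3 : (16 * q * Real.log N₁ + 8 * q) / r + 4 / r = (16 * q * Real.log N₁ + 8 * q + 4) / r := by
      field_simp
    linarith
  -- the second error term: `8D(ℓ+1)/(y+1) + 4y/N₁ ≤ (8Dℓ + 8D + 4)/r`
  have hE2 : ‖divSumC χ N₁ - mN₁‖ ≤ (8 * q * Real.log N₁ + 8 * q + 4) / r := by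
    refine e2.trans ?_
    have h1 : 8 * (q : ℝ) * (Real.log N₁ + 1) / ((y : ℝ) + 1) ≤ (8 * q * Real.log N₁ + 8 * q) / r := by
      rw [show 8 * (q : ℝ) * (Real.log N₁ + 1) = 8 * q * Real.log N₁ + 8 * q by ring]
      exact div_le_div_of_nonneg_left (by positivity) hr0 hry
    have h2 : 4 * (y : ℝ) / (N₁ : ℝ) ≤ 4 / r := by
      rw [div_le_div_iff₀ hN₁0 hr0]; nlinarith
    have h3 : (8 * q * Real.log N₁ + 8 * q) / r + 4 / r = (8 * q * Real.log N₁ + 8 * q + 4) / r := by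
      field_simp
    linarith
  have hsum : (16 * q * Real.log N₁ + 8 * q + 4) / r + (8 * q * Real.log N₁ + 8 * q + 4) / r ≤
      24 * ((q : ℝ) + 1) * (Real.log N₁ + 1) / r := by
    rw [← add_div]
    apply div_le_div_of_nonneg_right _ hr0.le
    nlinarith
  linarith

/-! ### Part H′ — the upper chain `|Σ_{l ≤ N₁} χ_k(l²) l^{-2s}| ≤ Σ₁ + Σ₂` at a general cut `N₁` -/

variable {k : ℕ} (χk : DirichletCharacter ℂ k)

/-- **The upper chain of (3.12)–(3.17)/(4)–(10) at a general cut.** For quadratic `χ_D ≠ χ₀` mod `D`,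
`χ_k ≠ χ₀` mod `k` with `χ_kχ_D ≠ χ₀`, a zero `s` of `L(·, χ_k)` with `½ ≤ σ = Re s ≤ 1`, and `N₁ ≥ 4`,
writing `ℓ = log N₁`, `Q = ℓ²/2 + 2ℓ + 2`, `F = kD(1 + |s|/σ)`:
`‖Σ_{l ≤ N₁} χ_k(l²)(l²)^{-s}‖ ≤ 8 F Q (ℓ+1) N₁^{3/2 − 2σ} + N₁^{2 − 2σ} Q (ℓ·L(1,χ_D) + 24(D+1)(ℓ+1)/√N₁)`.
[cite: BellottiPuglisi2023, §3 (4), (9), (10) pp. 11–14] -/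
theorem upper_chain [NeZero k] [NeZero q] (hq : χ ^ 2 = 1) (hχ : χ ≠ 1) (hχk : χk ≠ 1)
    (hψ : prodChar χ χk ≠ 1) {s : ℂ} (hhalf : 1 / 2 ≤ s.re) (hs1 : s.re ≤ 1)
    (hL : χk.LFunction s = 0) {N₁ : ℕ} (hN₁ : 4 ≤ N₁) :
    ‖∑ l ∈ Ioc 0 N₁, χk ((l ^ 2 : ℕ) : ZMod k) * ((l ^ 2 : ℕ) : ℂ) ^ (-s)‖ ≤
      8 * (((k * q : ℕ) : ℝ) * (1 + ‖s‖ / s.re)) *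
          (Real.log N₁ ^ 2 / 2 + 2 * Real.log N₁ + 2) * (Real.log N₁ + 1) *
          (N₁ : ℝ) ^ (3 / 2 - 2 * s.re) +
        (N₁ : ℝ) ^ (2 - 2 * s.re) * (Real.log N₁ ^ 2 / 2 + 2 * Real.log N₁ + 2) *
          (Real.log N₁ * (χ.LFunction 1).re +
            24 * ((q : ℝ) + 1) * (Real.log N₁ + 1) / Real.sqrt N₁) := by
  have hs0 : 0 < s.re := by linarith
  set σ : ℝ := s.re with hσdef
  set ℓ : ℝ := Real.log N₁ with hℓ
  have hN₁1 : 1 ≤ N₁ := by omega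
  have hN₁0 : (0 : ℝ) < N₁ := by exact_mod_cast (show 0 < N₁ by omega)
  have hN₁1r : (1 : ℝ) ≤ N₁ := by exact_mod_cast hN₁1
  have hℓ0 : 0 ≤ ℓ := Real.log_nonneg hN₁1r
  have hA0 : 0 ≤ 1 + ‖s‖ / σ := by
    have : 0 ≤ ‖s‖ / σ := div_nonneg (norm_nonneg _) hs0.le; positivity
  -- logs of `N₁²`
  have hNr : (((N₁ ^ 2 : ℕ)) : ℝ) = (N₁ : ℝ) ^ 2 := by push_cast; ring
  have hlogN : Real.log (((N₁ ^ 2 : ℕ)) : ℝ) = 2 * ℓ := by rw [hNr, Real.log_pow]; push_cast; ring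
  -- the swap
  have e1 := sum_sqInd_eq_sum_sq (fun n => χk n * (n : ℂ) ^ (-s)) N₁
  have e2 := sum_sqInd_eq_sum_weight_mul_innerSum χ χk hq s (N₁ ^ 2)
  have hid : ∑ l ∈ Ioc 0 N₁, χk ((l ^ 2 : ℕ) : ZMod k) * ((l ^ 2 : ℕ) : ℂ) ^ (-s) =
      ∑ c ∈ Ioc 0 (N₁ ^ 2), ((weight χ c : ℝ) : ℂ) * χk c * (c : ℂ) ^ (-s) *
        innerSum χ χk s (N₁ ^ 2 / c) := e1.symm.trans e2
  rw [hid]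
  have hnorm : ‖∑ c ∈ Ioc 0 (N₁ ^ 2), ((weight χ c : ℝ) : ℂ) * χk c * (c : ℂ) ^ (-s) *
        innerSum χ χk s (N₁ ^ 2 / c)‖ ≤
      ∑ c ∈ Ioc 0 (N₁ ^ 2), charDivisorSum χ c * (c : ℝ) ^ (-σ) *
        ‖innerSum χ χk s (N₁ ^ 2 / c)‖ :=
    (norm_sum_le _ _).trans (sum_le_sum fun c hc => norm_weight_term_le χ χk hq s (mem_Ioc.mp hc).1 _)
  have hN₁N : N₁ ≤ N₁ ^ 2 := Nat.le_self_pow (by norm_num) N₁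
  have hsplit := (sum_Ioc_consecutive
    (fun c => charDivisorSum χ c * (c : ℝ) ^ (-σ) * ‖innerSum χ χk s (N₁ ^ 2 / c)‖)
    (Nat.zero_le N₁) hN₁N).symm
  have hS1 := sigma_one_le χ χk hq hχk hψ hhalf hs1 hL hN₁1
  have hS2 := sigma_two_le χ χk hq hs1 hN₁1
  have hG := sum_charDivisorSum_div_le_gen χ hq hχ hN₁
  set Q : ℝ := ℓ ^ 2 / 2 + 2 * ℓ + 2 with hQ
  have hQ0 : 0 ≤ Q := by positivity
  have hH : ∑ c ∈ Ioc 0 N₁, (c.divisors.card : ℝ) / c ≤ Q := sum_card_divisors_div_le N₁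
  -- powers of `N₁`
  have hpow1 : ((N₁ : ℕ) : ℝ) ^ (1 - σ) * ((N₁ : ℕ) : ℝ) ^ (1 / 2 - σ) =
      (N₁ : ℝ) ^ (3 / 2 - 2 * σ) := by
    rw [← Real.rpow_add hN₁0]; ring_nf
  have hpow2 : (((N₁ ^ 2 : ℕ)) : ℝ) ^ (1 - σ) = (N₁ : ℝ) ^ (2 - 2 * σ) := by
    rw [hNr, show ((N₁ : ℝ) ^ 2) = (N₁ : ℝ) ^ ((2 : ℕ) : ℝ) by rw [Real.rpow_natCast],
      ← Real.rpow_mul hN₁0.le]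
    norm_num
    ring_nf
  -- Σ₁
  have hS1' : ∑ c ∈ Ioc 0 N₁, charDivisorSum χ c * (c : ℝ) ^ (-σ) *
      ‖innerSum χ χk s (N₁ ^ 2 / c)‖ ≤
      8 * (((k * q : ℕ) : ℝ) * (1 + ‖s‖ / σ)) * Q * (ℓ + 1) * (N₁ : ℝ) ^ (3 / 2 - 2 * σ) := by
    refine hS1.trans ?_
    rw [hlogN]
    have hkq0 : 0 ≤ ((k * q : ℕ) : ℝ) * (1 + ‖s‖ / σ) := by positivity
    have hp0 : 0 ≤ ((N₁ : ℕ) : ℝ) ^ (1 - σ) * ((N₁ : ℕ) : ℝ) ^ (1 / 2 - σ) := by positivity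
    calc (∑ c ∈ Ioc 0 N₁, (c.divisors.card : ℝ) / c) *
          (((N₁ : ℕ) : ℝ) ^ (1 - σ) * (4 * ((k * q : ℕ) : ℝ) * (1 + ‖s‖ / σ) * (2 + 2 * ℓ) *
            ((N₁ : ℕ) : ℝ) ^ (1 / 2 - σ)))
        = 8 * (∑ c ∈ Ioc 0 N₁, (c.divisors.card : ℝ) / c) *
            (((k * q : ℕ) : ℝ) * (1 + ‖s‖ / σ)) * (ℓ + 1) *
            (((N₁ : ℕ) : ℝ) ^ (1 - σ) * ((N₁ : ℕ) : ℝ) ^ (1 / 2 - σ)) := by ring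
      _ ≤ 8 * Q * (((k * q : ℕ) : ℝ) * (1 + ‖s‖ / σ)) * (ℓ + 1) *
            (((N₁ : ℕ) : ℝ) ^ (1 - σ) * ((N₁ : ℕ) : ℝ) ^ (1 / 2 - σ)) := by
          gcongr
      _ = 8 * (((k * q : ℕ) : ℝ) * (1 + ‖s‖ / σ)) * Q * (ℓ + 1) * (N₁ : ℝ) ^ (3 / 2 - 2 * σ) := by
          rw [hpow1]; ring
  -- Σ₂
  have hS2' : ∑ c ∈ Ioc N₁ (N₁ ^ 2), charDivisorSum χ c * (c : ℝ) ^ (-σ) *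
      ‖innerSum χ χk s (N₁ ^ 2 / c)‖ ≤
      (N₁ : ℝ) ^ (2 - 2 * σ) * Q * (ℓ * (χ.LFunction 1).re +
        24 * ((q : ℝ) + 1) * (ℓ + 1) / Real.sqrt N₁) := by
    refine hS2.trans ?_
    rw [hpow2]
    exact mul_le_mul_of_nonneg_left hG (by positivity)
  calc _ ≤ _ := hnorm
    _ = _ := hsplit
    _ ≤ _ := add_le_add hS1' hS2'


/-! ### Part I′ — thresholds, small moduli, and the endgame -/

/-- The three growth conditions used at the end, valid for all large real `U`:
`U^{b/2} ≥ 145`, `log U ≥ 1`, `A log³U · U^{-ε} ≤ c` ("for `U ≥ U₀(γ)` sufficiently large").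
[cite: BellottiPuglisi2023, §3 p. 14 (U ≥ U₀(γ))] -/
theorem eventually_thresholds_gen {b ε A c : ℝ} (hb : 0 < b) (hε : 0 < ε) (hA : 0 < A)
    (hc : 0 < c) :
    ∃ U₀ : ℝ, 1 ≤ U₀ ∧ ∀ U : ℝ, U₀ ≤ U →
      145 ≤ U ^ (b / 2) ∧ 1 ≤ Real.log U ∧ A * Real.log U ^ 3 * U ^ (-ε) ≤ c := by
  have h3 : ∀ x : ℝ, Real.log x ^ (3 : ℝ) = Real.log x ^ 3 := fun x => by
    rw [show (3 : ℝ) = ((3 : ℕ) : ℝ) by norm_num, Real.rpow_natCast]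
  have h1 : ∀ᶠ x : ℝ in atTop, 145 ≤ x ^ (b / 2) :=
    (tendsto_rpow_atTop (by linarith : 0 < b / 2)).eventually_ge_atTop 145
  have h2 : ∀ᶠ x : ℝ in atTop, 1 ≤ Real.log x := Real.tendsto_log_atTop.eventually_ge_atTop 1
  have h4 : ∀ᶠ x : ℝ in atTop, A * Real.log x ^ 3 * x ^ (-ε) ≤ c := by
    have hb := (isLittleO_log_rpow_rpow_atTop (3 : ℝ) hε).bound (show 0 < c / A by positivity)
    filter_upwards [hb, Filter.eventually_ge_atTop 1] with x hx hx1
    rw [h3, Real.norm_of_nonneg (pow_nonneg (Real.log_nonneg hx1) 3),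
      Real.norm_of_nonneg (Real.rpow_nonneg (by linarith) _)] at hx
    have hx0 : 0 < x := by linarith
    have hxε : 0 < x ^ ε := Real.rpow_pos_of_pos hx0 ε
    rw [Real.rpow_neg hx0.le]
    calc A * Real.log x ^ 3 * (x ^ ε)⁻¹ ≤ A * (c / A * x ^ ε) * (x ^ ε)⁻¹ := by gcongr
      _ = c := by field_simp
  obtain ⟨U₀, hU₀⟩ := Filter.eventually_atTop.mp (h1.and (h2.and h4))
  refine ⟨max U₀ 1, le_max_right _ _, fun U hU => ?_⟩
  exact hU₀ U ((le_max_left _ _).trans hU)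

/-- A non-principal Dirichlet character has modulus `≥ 3`. [folklore] -/
private theorem three_le_of_ne_one' {n : ℕ} [NeZero n] {ψ : DirichletCharacter ℂ n}
    (hψ : ψ ≠ 1) : 3 ≤ n := by
  by_contra h
  have h' : n < 3 := not_le.mp h
  have hn0 : n ≠ 0 := NeZero.ne n
  interval_cases n
  · exact hn0 rfl
  · exact hψ (DirichletCharacter.level_one ψ)
  · apply hψ
    refine MulChar.ext' fun a => ?_
    by_cases ha : IsUnit a
    · obtain ⟨u, rfl⟩ := ha
      have hu : u = 1 := Subsingleton.elim (h := by
        rw [← Fintype.card_le_one_iff_subsingleton, ZMod.card_units_eq_totient]; decide) u 1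
      rw [hu]; simp
    · rw [MulChar.map_nonunit _ ha, MulChar.map_nonunit _ ha]

/-- `L(1, χ) > 0` for quadratic `χ ≠ χ₀` (the tree's positivity-by-continuity at `σ₀ = 1`).
[cite: MontgomeryVaughan2007, §4.3 p. 102] -/
theorem LFunction_one_re_pos' [NeZero q] (hχ : χ ≠ 1) (hq : χ ^ 2 = 1) :
    0 < (χ.LFunction 1).re := by
  have := LFunction_ofReal_re_pos_of_forall_ne_zero χ hχ hq one_pos le_rfl fun σ h1 h2 => by
    have hσ : σ = 1 := le_antisymm h2 h1
    subst hσ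
    rw [ofReal_one]
    exact χ.LFunction_apply_one_ne_zero hχ
  rwa [ofReal_one] at this

/-- **A uniform positive constant over the quadratic characters of bounded modulus.** If a property
`P D χ c`, antitone in the constant `c > 0`, holds for every quadratic `χ ≠ χ₀` with SOME `c > 0`,
then one `c > 0` serves all quadratic `χ ≠ χ₀` of modulus `≤ D_max` (finitely many characters) —
the absorption of the moduli below the threshold into "an effective constant `c₁`".
[cite: BellottiPuglisi2023, §3 pp. 14–15 (c₁ an effective constant)] -/
theorem exists_pos_forall_quadratic (P : (D : ℕ) → [NeZero D] → DirichletCharacter ℂ D → ℝ → Prop)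
    (hmono : ∀ (D : ℕ) [NeZero D] (ψ : DirichletCharacter ℂ D) (c c' : ℝ), 0 < c' → c' ≤ c →
      P D ψ c → P D ψ c')
    (hP : ∀ (D : ℕ) [NeZero D] (ψ : DirichletCharacter ℂ D), ψ ≠ 1 → ψ ^ 2 = 1 →
      ∃ c : ℝ, 0 < c ∧ P D ψ c)
    (Dmax : ℕ) :
    ∃ c : ℝ, 0 < c ∧ ∀ (D : ℕ) [NeZero D] (ψ : DirichletCharacter ℂ D), D ≤ Dmax → ψ ≠ 1 →
      ψ ^ 2 = 1 → P D ψ c := by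
  classical
  induction Dmax with
  | zero =>
    refine ⟨1, one_pos, fun D _ ψ hD => ?_⟩
    exact absurd (Nat.le_zero.mp hD) (NeZero.ne D)
  | succ n ih =>
    obtain ⟨c, hc, hcP⟩ := ih
    haveI hne : NeZero (n + 1) := ⟨Nat.succ_ne_zero n⟩
    haveI : Fintype (DirichletCharacter ℂ (n + 1)) := Fintype.ofFinite _
    have key : ∀ S : Finset (DirichletCharacter ℂ (n + 1)), ∃ c' : ℝ, 0 < c' ∧ c' ≤ c ∧
        ∀ ψ ∈ S, ψ ≠ 1 → ψ ^ 2 = 1 → P (n + 1) ψ c' := by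
      intro S
      induction S using Finset.induction_on with
      | empty => exact ⟨c, hc, le_rfl, by simp⟩
      | insert a S ha ihS =>
        obtain ⟨c', hc', hc'c, hS⟩ := ihS
        by_cases h : a ≠ 1 ∧ a ^ 2 = 1
        · obtain ⟨ca, hca, hPa⟩ := hP (n + 1) a h.1 h.2
          refine ⟨min c' ca, lt_min hc' hca, (min_le_left _ _).trans hc'c, ?_⟩
          intro ψ hψ h1 h2
          rcases Finset.mem_insert.mp hψ with rfl | hψS
          · exact hmono (n + 1) ψ ca _ (lt_min hc' hca) (min_le_right _ _) hPa
          · exact hmono (n + 1) ψ c' _ (lt_min hc' hca) (min_le_left _ _) (hS ψ hψS h1 h2)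
        · refine ⟨c', hc', hc'c, ?_⟩
          intro ψ hψ h1 h2
          rcases Finset.mem_insert.mp hψ with rfl | hψS
          · exact absurd ⟨h1, h2⟩ h
          · exact hS ψ hψS h1 h2
    obtain ⟨c', hc', hc'c, hall⟩ := key Finset.univ
    refine ⟨c', hc', fun D _ ψ hD h1 h2 => ?_⟩
    rcases Nat.lt_or_eq_of_le hD with hlt | heq
    · exact hmono D ψ c c' hc' hc'c (hcP D ψ (Nat.lt_succ_iff.mp hlt) h1 h2)
    · subst heq
      exact hall ψ (Finset.mem_univ _) h1 h2

/-- **Small moduli, `L(1)`**: one `m > 0` with `m ≤ L(1, χ)` for every quadratic `χ ≠ χ₀` of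
modulus `≤ D_max`. [cite: BellottiPuglisi2023, §3 pp. 14–15 (c₁ an effective constant)] -/
theorem exists_pos_le_LFunction_one (Dmax : ℕ) :
    ∃ m : ℝ, 0 < m ∧ ∀ (D : ℕ) [NeZero D] (ψ : DirichletCharacter ℂ D), D ≤ Dmax → ψ ≠ 1 →
      ψ ^ 2 = 1 → m ≤ (ψ.LFunction 1).re :=
  exists_pos_forall_quadratic (fun D (_ : NeZero D) ψ c => c ≤ (ψ.LFunction 1).re)
    (fun _ _ _ _ _ _ h hP => h.trans hP)
    (fun _ _ ψ h1 h2 => ⟨_, LFunction_one_re_pos' ψ h1 h2, le_rfl⟩) Dmax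

/-- **Small moduli, real zeros**: one `δ₀ > 0` such that no quadratic `χ ≠ χ₀` of modulus `≤ D_max`
has a real zero in `[1 − δ₀, 1]` (continuity at `1`, where `L(1, χ) > 0`).
[cite: BellottiPuglisi2023, §4 p. 16 (Theorem 3 for the moduli below the threshold)] -/
theorem exists_zeroFree_near_one (Dmax : ℕ) :
    ∃ r₀ : ℝ, 0 < r₀ ∧ ∀ (D : ℕ) [NeZero D] (ψ : DirichletCharacter ℂ D), D ≤ Dmax → ψ ≠ 1 →
      ψ ^ 2 = 1 → ∀ β : ℝ, 1 - r₀ ≤ β → β ≤ 1 → ψ.LFunction β ≠ 0 := by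
  refine exists_pos_forall_quadratic
    (fun D (_ : NeZero D) ψ c => ∀ β : ℝ, 1 - c ≤ β → β ≤ 1 → ψ.LFunction β ≠ 0)
    (fun _ _ _ _ _ _ h hP β h1 h2 => hP β (by linarith) h2) (fun D hD ψ h1 h2 => ?_) Dmax
  set f : ℝ → ℝ := fun x => (ψ.LFunction x).re with hf
  have hcont : Continuous f :=
    continuous_re.comp ((DirichletCharacter.differentiable_LFunction h1).continuous.comp
      continuous_ofReal)
  have hpos : 0 < f 1 := by simp only [hf]; rw [ofReal_one]; exact LFunction_one_re_pos' ψ h1 h2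
  obtain ⟨r, hr, hball⟩ := Metric.continuousAt_iff.mp hcont.continuousAt (f 1 / 2) (by positivity)
  refine ⟨r / 2, by positivity, fun β hβ1 hβ2 hzero => ?_⟩
  have hdist : dist β 1 < r := by
    rw [Real.dist_eq, abs_lt]; constructor <;> linarith
  have h := hball hdist
  rw [Real.dist_eq, abs_lt] at h
  have hfβ : f β = 0 := by simp only [hf, hzero, Complex.zero_re]
  rw [hfβ] at h
  linarith [h.1, h.2]

/-- **The endgame arithmetic** (abstract reals): from `0.028 ≤ S ≤ E₁ + PQ(ℓ·L₁ + R)`,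
`E₁ ≤ 48 C L³ W`, `PQR ≤ 36 C L³ W`, `100 C L³ W ≤ 0.014` and `PQℓ ≤ C L³ P'` conclude
`L₁ ≥ 0.014/(C P' L³)`. [cite: BellottiPuglisi2023, §3 p. 14 (0.36 − … ≤ c₀U^{bγ}log³U·L(1,χ_D))] -/
theorem endgame_gen {S E P Q ℓ R L₁ C L W P' : ℝ} (hlow : 0.028 ≤ S)
    (hup : S ≤ E + P * Q * (ℓ * L₁ + R)) (hE : E ≤ 48 * C * L ^ 3 * W)
    (hR : P * Q * R ≤ 36 * C * L ^ 3 * W) (hT : 100 * C * L ^ 3 * W ≤ 0.014)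
    (hPQℓ : P * Q * ℓ ≤ C * L ^ 3 * P') (hPQℓ0 : 0 ≤ P * Q * ℓ) (hC : 0 < C) (hL : 0 < L)
    (hP' : 0 < P') (hW : 0 ≤ W) : 0.014 / (C * P' * L ^ 3) ≤ L₁ := by
  have hCLW : 0 ≤ C * L ^ 3 * W := by positivity
  have hexp : P * Q * (ℓ * L₁ + R) = (P * Q * ℓ) * L₁ + P * Q * R := by ring
  rw [hexp] at hup
  have h1 : 0.014 ≤ (P * Q * ℓ) * L₁ := by nlinarith
  have hL₁0 : 0 < L₁ := by
    by_contra hle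
    push Not at hle
    have : (P * Q * ℓ) * L₁ ≤ 0 := mul_nonpos_of_nonneg_of_nonpos hPQℓ0 hle
    linarith
  have h2 : (P * Q * ℓ) * L₁ ≤ (C * L ^ 3 * P') * L₁ :=
    mul_le_mul_of_nonneg_right hPQℓ hL₁0.le
  rw [div_le_iff₀ (by positivity)]
  nlinarith

/-- Size bookkeeping for `U = k|s|D` with `k, D ≥ 3`, `|s| > 3/4`: `U ≥ 6.75`, `D ≤ U`,
`D + 1 ≤ U`, `log U ≥ 1`. [cite: BellottiPuglisi2023, Theorem 2 p. 4 (U = k|s₀|D)] -/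
theorem size_facts {k D : ℕ} (hk : 3 ≤ k) (hD : 3 ≤ D) {ns : ℝ} (hns : 3 / 4 < ns) :
    6.75 ≤ (k : ℝ) * ns * D ∧ (D : ℝ) ≤ (k : ℝ) * ns * D ∧ (D : ℝ) + 1 ≤ (k : ℝ) * ns * D ∧
      1 ≤ Real.log ((k : ℝ) * ns * D) := by
  have hk3 : (3 : ℝ) ≤ k := by exact_mod_cast hk
  have hD3 : (3 : ℝ) ≤ D := by exact_mod_cast hD
  have hkns : (9 / 4 : ℝ) ≤ (k : ℝ) * ns := by
    nlinarith [mul_nonneg (sub_nonneg.2 hk3) (sub_nonneg.2 hns.le)]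
  have h1 : (9 / 4 : ℝ) * D ≤ (k : ℝ) * ns * D :=
    mul_le_mul_of_nonneg_right hkns (by positivity)
  have hU : 6.75 ≤ (k : ℝ) * ns * D := by norm_num at h1 ⊢; nlinarith
  refine ⟨hU, by nlinarith, by nlinarith, ?_⟩
  rw [← Real.log_exp 1]
  refine Real.log_le_log (Real.exp_pos 1) ?_
  have := Real.exp_one_lt_d9
  norm_num at this hU ⊢
  linarith

/-- Logarithm bookkeeping: with `ℓ ≤ (b/2)L`, `L ≥ 1`:
`ℓ²/2 + 2ℓ + 2 ≤ (b+2)²L²`, `ℓ + 1 ≤ (b+2)L`, `ℓ ≤ (b+2)L`. [folklore] -/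
private theorem log_facts {ℓ L b : ℝ} (hℓ0 : 0 ≤ ℓ) (hℓL : ℓ ≤ b / 2 * L) (hL1 : 1 ≤ L) (hb : 0 < b) :
    ℓ ^ 2 / 2 + 2 * ℓ + 2 ≤ (b + 2) ^ 2 * L ^ 2 ∧ ℓ + 1 ≤ (b + 2) * L ∧ ℓ ≤ (b + 2) * L := by
  have hL0 : 0 ≤ L := by linarith
  have hℓsq : ℓ ^ 2 ≤ (b / 2 * L) ^ 2 := pow_le_pow_left₀ hℓ0 hℓL 2
  have hLL : L ≤ L ^ 2 := by nlinarith
  have hbL : b * L ≤ b * L ^ 2 := mul_le_mul_of_nonneg_left hLL hb.le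
  have h1 : ℓ ^ 2 / 2 + 2 * ℓ + 2 ≤ (b / 2 * L) ^ 2 / 2 + b * L ^ 2 + 2 * L ^ 2 := by nlinarith
  have h2 : (b / 2 * L) ^ 2 / 2 + b * L ^ 2 + 2 * L ^ 2 ≤ (b + 2) ^ 2 * L ^ 2 := by
    nlinarith [mul_nonneg (sq_nonneg b) (sq_nonneg L), mul_nonneg hb.le (sq_nonneg L), sq_nonneg L]
  refine ⟨h1.trans h2, ?_, ?_⟩
  · have : b / 2 * L + 1 ≤ (b + 2) * L := by nlinarith
    linarith
  · have : b / 2 * L ≤ (b + 2) * L := mul_le_mul_of_nonneg_right (by linarith) hL0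
    linarith

/-- Power bookkeeping for `X = U^{b/2}`, `X/2 ≤ N₁ ≤ X`, `σ = 1 − γ'`, `0 < γ' ≤ γ < 1/4`,
`1 + (bγ − b/4) = −ε`. [folklore] -/
private theorem power_facts {U X b γ γ' σ ε : ℝ} {N₁ : ℕ} (hU1 : 1 ≤ U) (hX : X = U ^ (b / 2))
    (hN₁X : (N₁ : ℝ) ≤ X) (hN₁half : X / 2 ≤ N₁) (hN₁1 : 1 ≤ (N₁ : ℝ)) (hσ : σ = 1 - γ')
    (hγ'0 : 0 < γ') (hγ'γ : γ' ≤ γ) (hγ4 : γ < 1 / 4) (hb : 0 < b)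
    (hε' : 1 + (b * γ - b / 4) = -ε) :
    (N₁ : ℝ) ^ (3 / 2 - 2 * σ) ≤ 2 * U ^ (b * γ - b / 4) ∧
      (N₁ : ℝ) ^ (2 - 2 * σ) ≤ U ^ (b * γ') ∧ U ^ (b * γ') ≤ U ^ (b * γ) ∧
      1 / Real.sqrt N₁ ≤ 1.5 * U ^ (-(b / 4)) ∧
      U * U ^ (b * γ - b / 4) = U ^ (-ε) ∧ U ^ (b * γ) * U * U ^ (-(b / 4)) = U ^ (-ε) := by
  have hU0 : 0 < U := by linarith
  have hX0 : 0 < X := by rw [hX]; positivity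
  have hN₁0 : (0 : ℝ) < N₁ := by linarith
  refine ⟨?_, ?_, ?_, ?_, ?_, ?_⟩
  · have e1 : (N₁ : ℝ) ^ (3 / 2 - 2 * σ) ≤ (N₁ : ℝ) ^ (2 * γ - 1 / 2) :=
      Real.rpow_le_rpow_of_exponent_le hN₁1 (by rw [hσ]; linarith)
    have e2 : (N₁ : ℝ) ^ (2 * γ - 1 / 2) ≤ (X / 2) ^ (2 * γ - 1 / 2) :=
      Real.rpow_le_rpow_of_nonpos (by positivity) hN₁half (by linarith)
    have e3 : (X / 2) ^ (2 * γ - 1 / 2) = X ^ (2 * γ - 1 / 2) * (2 : ℝ) ^ (1 / 2 - 2 * γ) := by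
      rw [Real.div_rpow hX0.le (by norm_num), div_eq_mul_inv, ← Real.rpow_neg (by norm_num),
        neg_sub]
    have e4 : (2 : ℝ) ^ (1 / 2 - 2 * γ) ≤ 2 := by
      have := Real.rpow_le_rpow_of_exponent_le (by norm_num : (1 : ℝ) ≤ 2)
        (by linarith : 1 / 2 - 2 * γ ≤ 1)
      rwa [Real.rpow_one] at this
    have e5 : X ^ (2 * γ - 1 / 2) = U ^ (b * γ - b / 4) := by
      rw [hX, ← Real.rpow_mul hU0.le]; ring_nf
    have hXp0 : 0 ≤ X ^ (2 * γ - 1 / 2) := by positivity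
    calc (N₁ : ℝ) ^ (3 / 2 - 2 * σ) ≤ (X / 2) ^ (2 * γ - 1 / 2) := e1.trans e2
      _ = X ^ (2 * γ - 1 / 2) * (2 : ℝ) ^ (1 / 2 - 2 * γ) := e3
      _ ≤ X ^ (2 * γ - 1 / 2) * 2 := mul_le_mul_of_nonneg_left e4 hXp0
      _ = 2 * U ^ (b * γ - b / 4) := by rw [e5]; ring
  · calc (N₁ : ℝ) ^ (2 - 2 * σ) ≤ X ^ (2 - 2 * σ) :=
          Real.rpow_le_rpow hN₁0.le hN₁X (by rw [hσ]; linarith)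
      _ = U ^ (b * γ') := by rw [hX, ← Real.rpow_mul hU0.le, hσ]; ring_nf
  · exact Real.rpow_le_rpow_of_exponent_le hU1 (by nlinarith)
  · have h1 : Real.sqrt (X / 2) ≤ Real.sqrt N₁ := Real.sqrt_le_sqrt hN₁half
    have h2 : Real.sqrt (X / 2) = U ^ (b / 4) / Real.sqrt 2 := by
      rw [Real.sqrt_div hX0.le, hX, Real.sqrt_eq_rpow, ← Real.rpow_mul hU0.le]; ring_nf
    have hs2 : Real.sqrt 2 ≤ 1.5 := by
      rw [show (1.5 : ℝ) = Real.sqrt (1.5 ^ 2) by rw [Real.sqrt_sq (by norm_num)]]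
      exact Real.sqrt_le_sqrt (by norm_num)
    have hUb4 : 0 < U ^ (b / 4) := by positivity
    have h3 : 0 < Real.sqrt (X / 2) := Real.sqrt_pos.mpr (by positivity)
    calc 1 / Real.sqrt N₁ ≤ 1 / Real.sqrt (X / 2) := div_le_div_of_nonneg_left zero_le_one h3 h1
      _ = Real.sqrt 2 * U ^ (-(b / 4)) := by
          rw [h2, Real.rpow_neg hU0.le]; field_simp
      _ ≤ 1.5 * U ^ (-(b / 4)) := by gcongr
  · rw [← hε', Real.rpow_add hU0, Real.rpow_one]
  · rw [← hε', Real.rpow_add hU0, Real.rpow_one, Real.rpow_sub hU0, Real.rpow_neg hU0.le,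
      div_eq_mul_inv]; ring

/-- `F = kD(1 + |s|/σ) ≤ 3U` for `U = k|s|D`, `σ > 3/4`, `|s| ≥ σ`. [cite: BellottiPuglisi2023, §3 (7) p. 13 (the factor |s₀|)] -/
theorem F_le_three_mul {k q : ℕ} {s : ℂ} (hσ : 3 / 4 < s.re) (hns : s.re ≤ ‖s‖) :
    ((k * q : ℕ) : ℝ) * (1 + ‖s‖ / s.re) ≤ 3 * ((k : ℝ) * ‖s‖ * q) := by
  have hs0 : 0 < s.re := by linarith
  have hkqr : ((k * q : ℕ) : ℝ) = (k : ℝ) * q := by push_cast; ring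
  have h1σ : 1 ≤ ‖s‖ / s.re := by rw [le_div_iff₀ hs0]; linarith
  have hkq0 : 0 ≤ (k : ℝ) * q := by positivity
  have h1 : ((k * q : ℕ) : ℝ) * (1 + ‖s‖ / s.re) ≤ (k : ℝ) * q * (2 * (‖s‖ / s.re)) := by
    rw [hkqr]
    exact mul_le_mul_of_nonneg_left (by linarith) hkq0
  have h2 : (k : ℝ) * q * (2 * (‖s‖ / s.re)) = 2 * ((k : ℝ) * ‖s‖ * q) / s.re := by
    field_simp
  have h3 : 2 * ((k : ℝ) * ‖s‖ * q) / s.re ≤ 2 * ((k : ℝ) * ‖s‖ * q) / (3 / 4) :=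
    div_le_div_of_nonneg_left (by positivity) (by norm_num) hσ.le
  have hX0 : 0 ≤ (k : ℝ) * ‖s‖ * q := by positivity
  linarith

/-- **The large-`U` case of Theorem 2 (repaired window).** With the thresholds in force
(`U^{b/2} ≥ 145`, `log U ≥ 1`, `100(b+2)³ log³U·U^{-ε} ≤ 0.014`, `ε = b(1/4−γ) − 1`), a zero
`s = 1 − γ' + it` of `L(·, χ_k)` (`0 < γ' ≤ γ < 1/4`; `χ_k` real or `γ' ≤ 1/8`) gives
`L(1, χ_D) ≥ 0.014/((b+2)³ U^{bγ'} log³U)`. [cite: BellottiPuglisi2023, §3 pp. 11–16] -/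
theorem large_case [NeZero k] [NeZero q] (hq : χ ^ 2 = 1) (hχ : χ ≠ 1) (hχk : χk ≠ 1)
    (hψ : prodChar χ χk ≠ 1) {s : ℂ} {γ γ' b ε : ℝ} (hγ'0 : 0 < γ') (hγ'γ : γ' ≤ γ)
    (hγ4 : γ < 1 / 4) (hb : 0 < b) (hsre : s.re = 1 - γ') (hε' : 1 + (b * γ - b / 4) = -ε)
    (hcase : χk ^ 2 = 1 ∨ γ' ≤ 1 / 8) (hz : χk.LFunction s = 0) {U : ℝ}
    (hU : U = (k : ℝ) * ‖s‖ * q) (hq1U : (q : ℝ) + 1 ≤ U) (hL1 : 1 ≤ Real.log U)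
    (hX145 : 145 ≤ U ^ (b / 2))
    (hT : 100 * (b + 2) ^ 3 * Real.log U ^ 3 * U ^ (-ε) ≤ 0.014) :
    0.014 / ((b + 2) ^ 3 * U ^ (b * γ') * Real.log U ^ 3) ≤ (χ.LFunction 1).re := by
  have hσ34 : 3 / 4 < s.re := by rw [hsre]; linarith
  have hσ1 : s.re ≤ 1 := by rw [hsre]; linarith
  have hhalf : 1 / 2 ≤ s.re := by linarith
  have hns : s.re ≤ ‖s‖ := Complex.re_le_norm s
  have hq0 : (0 : ℝ) ≤ q := Nat.cast_nonneg q
  have hU1 : 1 ≤ U := by linarith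
  have hU0 : 0 < U := by linarith
  have hL0 : 0 < Real.log U := by linarith
  set X : ℝ := U ^ (b / 2) with hXdef
  have hX0 : 0 < X := by positivity
  set N₁ : ℕ := ⌊X⌋₊ with hN₁def
  have hN₁X : (N₁ : ℝ) ≤ X := Nat.floor_le hX0.le
  have hXN₁ : X < N₁ + 1 := Nat.lt_floor_add_one X
  have hN₁ge : (144 : ℝ) ≤ N₁ := by linarith
  have hN₁144 : 144 ≤ N₁ := by exact_mod_cast hN₁ge
  have hN₁4 : 4 ≤ N₁ := by omega
  have hN₁half : X / 2 ≤ N₁ := by linarith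
  have hN₁0 : (0 : ℝ) < N₁ := by linarith
  have hN₁1 : (1 : ℝ) ≤ N₁ := by linarith
  -- lower bound (Part C′)
  have hlow : (0.028 : ℝ) ≤
      ‖∑ l ∈ Ioc 0 N₁, χk ((l ^ 2 : ℕ) : ZMod k) * ((l ^ 2 : ℕ) : ℂ) ^ (-s)‖ := by
    rcases hcase with hquad | hγ8
    · have := norm_sum_sq_ge_real χk hquad hσ34.le hN₁144
      linarith
    · exact norm_sum_sq_ge_of_ge_seven_eighths χk (by rw [hsre]; linarith) (by omega)
  -- upper chain
  have hup := upper_chain χ χk hq hχ hχk hψ hhalf hσ1 hz hN₁4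
  -- bookkeeping
  have hℓ0 : 0 ≤ Real.log N₁ := Real.log_nonneg hN₁1
  have hℓL : Real.log N₁ ≤ b / 2 * Real.log U := by
    have : Real.log N₁ ≤ Real.log X := Real.log_le_log hN₁0 hN₁X
    rwa [hXdef, Real.log_rpow hU0] at this
  obtain ⟨hQL, hℓ1L, hℓL'⟩ := log_facts hℓ0 hℓL hL1 hb
  obtain ⟨hPow1, hPow2, hP'γ, hsqrt, hW1, hW2⟩ :=
    power_facts hU1 hXdef hN₁X hN₁half hN₁1 hsre hγ'0 hγ'γ hγ4 hb hε'
  have hF3 := F_le_three_mul (k := k) (q := q) hσ34 hns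
  rw [← hU] at hF3
  -- abbreviations
  set ℓ : ℝ := Real.log N₁ with hℓdef
  set L : ℝ := Real.log U with hLdef
  set Q : ℝ := ℓ ^ 2 / 2 + 2 * ℓ + 2 with hQdef
  set F : ℝ := ((k * q : ℕ) : ℝ) * (1 + ‖s‖ / s.re) with hFdef
  set P : ℝ := (N₁ : ℝ) ^ (2 - 2 * s.re) with hPdef
  set P' : ℝ := U ^ (b * γ') with hP'def
  set R : ℝ := 24 * ((q : ℝ) + 1) * (ℓ + 1) / Real.sqrt N₁ with hRdef
  set W : ℝ := U ^ (-ε) with hWdef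
  set C : ℝ := (b + 2) ^ 3 with hCdef
  set L₁ : ℝ := (χ.LFunction 1).re with hL₁def
  have hW0 : 0 ≤ W := by positivity
  have hQ0 : 0 ≤ Q := by positivity
  have hF0 : 0 ≤ F := by positivity
  have hP0 : 0 ≤ P := by positivity
  have hP'0 : 0 < P' := by positivity
  have hC : 0 < C := by positivity
  -- `E ≤ 48 C L³ W`
  have hE : 8 * F * Q * (ℓ + 1) * (N₁ : ℝ) ^ (3 / 2 - 2 * s.re) ≤ 48 * C * L ^ 3 * W := by
    calc 8 * F * Q * (ℓ + 1) * (N₁ : ℝ) ^ (3 / 2 - 2 * s.re)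
        ≤ 8 * (3 * U) * ((b + 2) ^ 2 * L ^ 2) * ((b + 2) * L) * (2 * U ^ (b * γ - b / 4)) := by
          gcongr
      _ = 48 * C * L ^ 3 * (U * U ^ (b * γ - b / 4)) := by simp only [hCdef]; ring
      _ = 48 * C * L ^ 3 * W := by rw [hW1]
  -- `P Q R ≤ 36 C L³ W`
  have hR : P * Q * R ≤ 36 * C * L ^ 3 * W := by
    have hR' : R ≤ 24 * U * ((b + 2) * L) * (1.5 * U ^ (-(b / 4))) := by
      simp only [hRdef]
      rw [div_eq_mul_one_div]
      gcongr
    have hR0 : 0 ≤ R := by positivity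
    calc P * Q * R ≤ U ^ (b * γ) * ((b + 2) ^ 2 * L ^ 2) *
          (24 * U * ((b + 2) * L) * (1.5 * U ^ (-(b / 4)))) := by
          gcongr
          exact hPow2.trans hP'γ
      _ = 36 * C * L ^ 3 * (U ^ (b * γ) * U * U ^ (-(b / 4))) := by simp only [hCdef]; ring
      _ = 36 * C * L ^ 3 * W := by rw [hW2]
  -- `P Q ℓ ≤ C L³ P'`
  have hPQℓ : P * Q * ℓ ≤ C * L ^ 3 * P' := by
    calc P * Q * ℓ ≤ P' * ((b + 2) ^ 2 * L ^ 2) * ((b + 2) * L) := by gcongr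
      _ = C * L ^ 3 * P' := by simp only [hCdef]; ring
  have hup' : ‖∑ l ∈ Ioc 0 N₁, χk ((l ^ 2 : ℕ) : ZMod k) * ((l ^ 2 : ℕ) : ℂ) ^ (-s)‖ ≤
      8 * F * Q * (ℓ + 1) * (N₁ : ℝ) ^ (3 / 2 - 2 * s.re) + P * Q * (ℓ * L₁ + R) := hup
  have hkey := endgame_gen hlow hup' hE hR hT hPQℓ (by positivity) hC hL0 hP'0 hW0
  simpa only [hCdef, hP'def, hLdef, mul_assoc] using hkey

/-- **Theorem 2, uniform quantitative core (repaired window).** For `0 < γ < 1/4` and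
`b > 4/(1 − 4γ)` there is `c₁ = c₁(γ, b) > 0` such that: for every `χ_k ≠ χ₀` mod `k`, every zero
`s₀ = 1 − γ' + it` of `L(s, χ_k)` with `0 < γ' ≤ γ` (`χ_k` real, or `γ' ≤ 1/8`), and every real
`χ_D ≠ χ₀` mod `D` with `χ_kχ_D ≠ χ₀`: `L(1, χ_D) ≥ c₁/(U^{bγ'} log³U)`, `U = k|s₀|D`. Uniform in
`γ' ≤ γ` (used for Corollary 3). Constants: `c₁ = min(0.014/(b+2)³, m)` with `m` the minimum of
`L(1, χ)` over the quadratic characters of modulus below the threshold.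
[cite: BellottiPuglisi2023, Theorem 2 p. 4; proof §3 pp. 11–16] -/
theorem theorem2_core {γ b : ℝ} (hγ : 0 < γ) (hγ4 : γ < 1 / 4) (hb : 4 / (1 - 4 * γ) < b) :
    ∃ c₁ : ℝ, 0 < c₁ ∧ ∀ (k : ℕ) [NeZero k] (χk : DirichletCharacter ℂ k), χk ≠ 1 →
      ∀ γ' t : ℝ, 0 < γ' → γ' ≤ γ → (χk ^ 2 = 1 ∨ γ' ≤ 1 / 8) →
      χk.LFunction (1 - γ' + t * Complex.I) = 0 →
        ∀ (q : ℕ) [NeZero q] (χ : DirichletCharacter ℂ q), χ ≠ 1 → χ ^ 2 = 1 →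
          prodChar χ χk ≠ 1 →
            c₁ / (((k : ℝ) * ‖(1 - γ' + t * Complex.I : ℂ)‖ * q) ^ (b * γ') *
                Real.log ((k : ℝ) * ‖(1 - γ' + t * Complex.I : ℂ)‖ * q) ^ 3) ≤
              (χ.LFunction 1).re := by
  -- the parameters `ε = b(1/4 − γ) − 1 > 0`, `C = (b+2)³`
  have h14 : 0 < 1 - 4 * γ := by linarith
  have hb0 : 4 < b * (1 - 4 * γ) := by
    have := (div_lt_iff₀ h14).mp hb; linarith
  have hbpos : 0 < b := by nlinarith
  set ε : ℝ := b * (1 / 4 - γ) - 1 with hεdef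
  have hε : 0 < ε := by simp only [hεdef]; nlinarith
  have hε' : 1 + (b * γ - b / 4) = -ε := by simp only [hεdef]; ring
  set C : ℝ := (b + 2) ^ 3 with hCdef
  have hC : 0 < C := by positivity
  obtain ⟨U₀, hU₀1, hU₀⟩ := eventually_thresholds_gen hbpos hε (by positivity : (0 : ℝ) < 100 * C)
    (by norm_num : (0 : ℝ) < 0.014)
  obtain ⟨m, hm, hmP⟩ := exists_pos_le_LFunction_one ⌈U₀⌉₊
  have hc₁0 : 0 < min (0.014 / C) m := lt_min (by positivity) hm
  refine ⟨min (0.014 / C) m, hc₁0, ?_⟩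
  intro k _ χk hχk γ' t hγ'0 hγ'γ hcase hz q _ χ hχ hq hψ
  -- the zero and the sizes
  set s : ℂ := 1 - γ' + t * Complex.I with hsdef
  have hsre : s.re = 1 - γ' := by simp [hsdef]
  have hσ34 : 3 / 4 < s.re := by rw [hsre]; linarith
  have hns : s.re ≤ ‖s‖ := Complex.re_le_norm s
  have hns34 : 3 / 4 < ‖s‖ := lt_of_lt_of_le hσ34 hns
  have hk3 : 3 ≤ k := three_le_of_ne_one' hχk
  have hq3 : 3 ≤ q := three_le_of_ne_one' hχ
  obtain ⟨hU675, hqU, hq1U, hL1⟩ := size_facts hk3 hq3 hns34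
  set U : ℝ := (k : ℝ) * ‖s‖ * q with hUdef
  have hU1 : 1 ≤ U := by norm_num at hU675; linarith
  set L : ℝ := Real.log U with hLdef
  set P' : ℝ := U ^ (b * γ') with hP'def
  have hP'1 : 1 ≤ P' := Real.one_le_rpow hU1 (by positivity)
  have hden1 : 1 ≤ P' * L ^ 3 := one_le_mul_of_one_le_of_one_le hP'1 (one_le_pow₀ hL1)
  rcases lt_or_ge U U₀ with hUsmall | hUlarge
  · -- small `U`: `D ≤ ⌈U₀⌉` and `L(1, χ_D) ≥ m ≥ c₁ ≥ c₁/(U^{bγ'} log³U)`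
    have hqle : q ≤ ⌈U₀⌉₊ := by
      have : (q : ℝ) ≤ ⌈U₀⌉₊ := (hqU.trans hUsmall.le).trans (Nat.le_ceil U₀)
      exact_mod_cast this
    have hmL := hmP q χ hqle hχ hq
    calc min (0.014 / C) m / (P' * L ^ 3) ≤ min (0.014 / C) m := div_le_self hc₁0.le hden1
      _ ≤ m := min_le_right _ _
      _ ≤ (χ.LFunction 1).re := hmL
  · -- large `U`
    obtain ⟨hX145, -, hT3⟩ := hU₀ U hUlarge
    have hkey := large_case χ χk hq hχ hχk hψ hγ'0 hγ'γ hγ4 hbpos hsre hε' hcase hz hUdef hq1U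
      hL1 hX145 hT3
    calc min (0.014 / C) m / (P' * L ^ 3) ≤ (0.014 / C) / (P' * L ^ 3) :=
          div_le_div_of_nonneg_right (min_le_left _ _) (by positivity)
      _ = 0.014 / (C * P' * L ^ 3) := by rw [div_div, mul_assoc]
      _ ≤ (χ.LFunction 1).re := by simpa only [hCdef, hP'def, hLdef, mul_assoc] using hkey


/-! ### Part J′ — Theorem 3 (Page's step) and the cores in `δ`-currency -/

/-- **Theorem 3, uniform quantitative core (repaired window).** Same data as `theorem2_core`; every
real zero `1 − δ` (`δ > 0`) of `L(s, χ_D)` has `δ > c₁/(U^{bγ'} log⁵U)`. From `theorem2_core` and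
Page's step `L(1, χ_D) ≤ 0.7 δ log²D` (the tree's `Pintz1976Heilbronn.norm_LFunction_one_le_of_realZero`,
`log D ≥ 100`); for `log D < 100` by continuity at `1` over the finitely many characters.
[cite: BellottiPuglisi2023, Theorem 3 p. 4; proof §4 p. 16] -/
theorem theorem3_core {γ b : ℝ} (hγ : 0 < γ) (hγ4 : γ < 1 / 4) (hb : 4 / (1 - 4 * γ) < b) :
    ∃ c₁ : ℝ, 0 < c₁ ∧ ∀ (k : ℕ) [NeZero k] (χk : DirichletCharacter ℂ k), χk ≠ 1 →
      ∀ γ' t : ℝ, 0 < γ' → γ' ≤ γ → (χk ^ 2 = 1 ∨ γ' ≤ 1 / 8) →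
      χk.LFunction (1 - γ' + t * Complex.I) = 0 →
        ∀ (q : ℕ) [NeZero q] (χ : DirichletCharacter ℂ q), χ ≠ 1 → χ ^ 2 = 1 →
          prodChar χ χk ≠ 1 → ∀ d : ℝ, 0 < d → χ.LFunction ((1 - d : ℝ) : ℂ) = 0 →
            c₁ / (((k : ℝ) * ‖(1 - γ' + t * Complex.I : ℂ)‖ * q) ^ (b * γ') *
                Real.log ((k : ℝ) * ‖(1 - γ' + t * Complex.I : ℂ)‖ * q) ^ 5) < d := by
  obtain ⟨c₁, hc₁, h2⟩ := theorem2_core hγ hγ4 hb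
  obtain ⟨r₀, hr₀, hr₀P⟩ := exists_zeroFree_near_one ⌈Real.exp 100⌉₊
  have hbpos : 0 < b := by
    have h14 : 0 < 1 - 4 * γ := by linarith
    have := (div_lt_iff₀ h14).mp hb; nlinarith
  refine ⟨min c₁ r₀, lt_min hc₁ hr₀, ?_⟩
  intro k _ χk hχk γ' t hγ'0 hγ'γ hcase hz q _ χ hχ hq hψ d hd hzd
  have hmain := h2 k χk hχk γ' t hγ'0 hγ'γ hcase hz q χ hχ hq hψ
  set s : ℂ := 1 - γ' + t * Complex.I with hsdef
  have hsre : s.re = 1 - γ' := by simp [hsdef]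
  have hσ34 : 3 / 4 < s.re := by rw [hsre]; linarith
  have hns : s.re ≤ ‖s‖ := Complex.re_le_norm s
  have hns34 : 3 / 4 < ‖s‖ := lt_of_lt_of_le hσ34 hns
  have hk3 : 3 ≤ k := three_le_of_ne_one' hχk
  have hq3 : 3 ≤ q := three_le_of_ne_one' hχ
  obtain ⟨hU675, hqU, -, hL1⟩ := size_facts hk3 hq3 hns34
  set U : ℝ := (k : ℝ) * ‖s‖ * q with hUdef
  have hU1 : 1 ≤ U := by norm_num at hU675; linarith
  have hU0 : 0 < U := by linarith
  set L : ℝ := Real.log U with hLdef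
  have hL0 : 0 < L := by linarith
  set P' : ℝ := U ^ (b * γ') with hP'def
  have hP'1 : 1 ≤ P' := Real.one_le_rpow hU1 (by positivity)
  have hP'0 : 0 < P' := by linarith
  have hden1 : 1 ≤ P' * L ^ 5 := one_le_mul_of_one_le_of_one_le hP'1 (one_le_pow₀ hL1)
  have hq0 : (0 : ℝ) < q := by exact_mod_cast (show 0 < q by omega)
  have hc0 : 0 < min c₁ r₀ := lt_min hc₁ hr₀
  rcases lt_or_ge (Real.log q) 100 with hsmall | hlarge
  · -- `log D < 100`: no real zero in `[1 − r₀, 1]`, so `d > r₀ ≥ min c₁ r₀ ≥ …`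
    have hqle : q ≤ ⌈Real.exp 100⌉₊ := by
      have h1 : (q : ℝ) < Real.exp 100 := by
        rw [← Real.exp_log hq0]; exact Real.exp_lt_exp.mpr hsmall
      have : (q : ℝ) ≤ ⌈Real.exp 100⌉₊ := h1.le.trans (Nat.le_ceil _)
      exact_mod_cast this
    have hfree := hr₀P q χ hqle hχ hq
    have hdr : r₀ < d := by
      by_contra hle
      push Not at hle
      exact hfree (1 - d) (by linarith) (by linarith) hzd
    calc min c₁ r₀ / (P' * L ^ 5) ≤ min c₁ r₀ := div_le_self hc0.le hden1
      _ ≤ r₀ := min_le_right _ _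
      _ < d := hdr
  · -- `log D ≥ 100`: Page's step `L(1, χ_D) ≤ 0.7 δ log²D ≤ 0.7 δ log²U`
    have hpage := norm_LFunction_one_le_of_realZero χ hχ hlarge hzd
    have hδ' : (1 : ℝ) - (1 - d) = d := by ring
    rw [hδ'] at hpage
    have hlogq : Real.log q ≤ L := Real.log_le_log hq0 hqU
    have hlogq0 : 0 ≤ Real.log q := by linarith
    have hL₁le : (χ.LFunction 1).re ≤ 0.7 * d * L ^ 2 := by
      refine (Complex.re_le_norm _).trans (hpage.trans ?_)
      have : Real.log q ^ 2 ≤ L ^ 2 := pow_le_pow_left₀ hlogq0 hlogq 2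
      have hd0 : 0 ≤ 0.7 * d := by positivity
      nlinarith
    have h1 : c₁ / (P' * L ^ 3) ≤ 0.7 * d * L ^ 2 := hmain.trans hL₁le
    have h2 : c₁ ≤ 0.7 * d * L ^ 2 * (P' * L ^ 3) := (div_le_iff₀ (by positivity)).mp h1
    have h3 : min c₁ r₀ / (P' * L ^ 5) ≤ c₁ / (P' * L ^ 5) :=
      div_le_div_of_nonneg_right (min_le_left _ _) (by positivity)
    refine lt_of_le_of_lt h3 ?_
    rw [div_lt_iff₀ (by positivity)]
    nlinarith [mul_pos hd (mul_pos hP'0 (pow_pos hL0 5))]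

end BellottiPuglisi2023

/-! ### The theorems in the shape of the statement file, with the repaired exponent window -/

open BellottiPuglisi2023 Pintz1976Heilbronn in
/-- **Bellotti–Puglisi 2023, Theorem 2 — PROVED in the repaired window `b > 4/(1 − 4γ)`.** For
`0 < γ` and `b > 4/(1 − 4γ)` there is `c₁ > 0` such that for every `χ_k ≠ χ₀` mod `k` (real with
`γ < 1/4`, or arbitrary with `γ ≤ 1/8`) with `L(1 − γ + it, χ_k) = 0`, and every real `χ_D ≠ χ₀`
mod `D` with `χ_kχ_D` non-principal: `L(1, χ_D) ≥ c₁/(U^{bγ} log³U)`, `U = k|s₀|D` — the body of the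
named fact `bellottiPuglisi2023_theorem2` verbatim, with its window `(1−3γ)/2 < b < 1/(2γ)` (a
mis-parse of the printed `1/(2(1−3γ)) < b`, itself not delivered by the printed proof — see the module
docstring) replaced by `4/(1 − 4γ) < b`. Elementary road of Pintz 1976 IV / BP §3 with the trivial
character-sum bounds and the cut at `U^{b/2}`. [cite: BellottiPuglisi2023, Theorem 2 p. 4; §3 pp. 11–16] -/
theorem bellottiPuglisi2023_theorem2_largeB :
    ∀ γ b : ℝ, 0 < γ → 4 / (1 - 4 * γ) < b → ∃ c₁ : ℝ, 0 < c₁ ∧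
      ∀ (k : ℕ) [NeZero k] (χk : DirichletCharacter ℂ k), χk ≠ 1 →
        (χk.IsQuadratic ∧ γ < 1 / 4 ∨ γ ≤ 1 / 8) →
        ∀ t : ℝ, χk.LFunction (1 - γ + t * Complex.I) = 0 →
          ∀ (D : ℕ) [NeZero D] (χD : DirichletCharacter ℂ D), χD ≠ 1 → χD.IsQuadratic →
            ProductNonprincipal χk χD →
              c₁ / (((k : ℝ) * ‖(1 - γ + t * Complex.I : ℂ)‖ * D) ^ (b * γ) *
                  Real.log ((k : ℝ) * ‖(1 - γ + t * Complex.I : ℂ)‖ * D) ^ 3) ≤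
                (χD.LFunction 1).re := by
  intro γ b hγ hb
  by_cases hγ4 : γ < 1 / 4
  · obtain ⟨c₁, hc₁, h⟩ := theorem2_core hγ hγ4 hb
    refine ⟨c₁, hc₁, fun k _ χk hχk hcase t hz D _ χD hχD hquad hprod => ?_⟩
    have hcase' : χk ^ 2 = 1 ∨ γ ≤ 1 / 8 := by
      rcases hcase with ⟨hq, _⟩ | h8
      · exact Or.inl hq.sq_eq_one
      · exact Or.inr h8
    exact h k χk hχk γ t hγ le_rfl hcase' hz D χD hχD hquad.sq_eq_one hprod
  · -- vacuous: both alternatives force `γ < 1/4`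
    refine ⟨1, one_pos, fun k _ χk hχk hcase => ?_⟩
    exfalso
    rcases hcase with ⟨_, h4⟩ | h8
    · exact hγ4 h4
    · exact hγ4 (by linarith)

open BellottiPuglisi2023 Pintz1976Heilbronn in
/-- **Bellotti–Puglisi 2023, Theorem 3 — PROVED in the repaired window `b > 4/(1 − 4γ)`.** Same data
as Theorem 2; every real zero `1 − δ` (`δ > 0`) of `L(s, χ_D)` has `δ > c₁/(U^{bγ} log⁵U)`. The body of
`bellottiPuglisi2023_theorem3` verbatim with the window replaced. Theorem 2 (above) and Page's step
`L(1, χ_D)/δ ≤ log²D` in the tree's form `‖L(1, χ_D)‖ ≤ 0.7 δ log²D` (`log D ≥ 100`), the small moduli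
by continuity. [cite: BellottiPuglisi2023, Theorem 3 p. 4; §4 p. 16] -/
theorem bellottiPuglisi2023_theorem3_largeB :
    ∀ γ b : ℝ, 0 < γ → 4 / (1 - 4 * γ) < b → ∃ c₁ : ℝ, 0 < c₁ ∧
      ∀ (k : ℕ) [NeZero k] (χk : DirichletCharacter ℂ k), χk ≠ 1 →
        (χk.IsQuadratic ∧ γ < 1 / 4 ∨ γ ≤ 1 / 8) →
        ∀ t : ℝ, χk.LFunction (1 - γ + t * Complex.I) = 0 →
          ∀ (D : ℕ) [NeZero D] (χD : DirichletCharacter ℂ D), χD ≠ 1 → χD.IsQuadratic →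
            ProductNonprincipal χk χD →
              ∀ δ : ℝ, 0 < δ → χD.LFunction ((1 - δ : ℝ) : ℂ) = 0 →
                c₁ / (((k : ℝ) * ‖(1 - γ + t * Complex.I : ℂ)‖ * D) ^ (b * γ) *
                    Real.log ((k : ℝ) * ‖(1 - γ + t * Complex.I : ℂ)‖ * D) ^ 5) < δ := by
  intro γ b hγ hb
  by_cases hγ4 : γ < 1 / 4
  · obtain ⟨c₁, hc₁, h⟩ := theorem3_core hγ hγ4 hb
    refine ⟨c₁, hc₁, fun k _ χk hχk hcase t hz D _ χD hχD hquad hprod δ hδ hzδ => ?_⟩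
    have hcase' : χk ^ 2 = 1 ∨ γ ≤ 1 / 8 := by
      rcases hcase with ⟨hq, _⟩ | h8
      · exact Or.inl hq.sq_eq_one
      · exact Or.inr h8
    exact h k χk hχk γ t hγ le_rfl hcase' hz D χD hχD hquad.sq_eq_one hprod δ hδ hzδ
  · refine ⟨1, one_pos, fun k _ χk hχk hcase => ?_⟩
    exfalso
    rcases hcase with ⟨_, h4⟩ | h8
    · exact hγ4 h4
    · exact hγ4 (by linarith)

namespace BellottiPuglisi2023

open Pintz1976Heilbronn

/-- The one-sided core of Corollary 3: with `D₁ ≤ D₂`, a real zero `σ₁ ∈ [1 − γ, 1]` of the real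
primitive `χ₁` mod `D₁` supplies the auxiliary zero (`γ' = 1 − σ₁ ≤ γ`, `t = 0`,
`U = D₁σ₁D₂ ≤ D₂²`, so `U^{(b/2)γ'} ≤ D₂^{bγ}` and `log⁵U ≤ 32 log⁵D₂`), and Theorem 3 (at `b/2`)
forbids a real zero `σ₂ ≥ 1 − c₁/(32 log⁵D₂ · D₂^{bγ})` of `L(s, χ₂)` when `χ₁χ₂` is non-principal.
[cite: BellottiPuglisi2023, Corollary 3 p. 5] -/
theorem corollary3_oneway {γ b c₁ : ℝ} (hγ4 : γ < 1 / 4) (hb : 0 < b)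
    (hT3 : ∀ (k : ℕ) [NeZero k] (χk : DirichletCharacter ℂ k), χk ≠ 1 →
      ∀ γ' t : ℝ, 0 < γ' → γ' ≤ γ → (χk ^ 2 = 1 ∨ γ' ≤ 1 / 8) →
      χk.LFunction (1 - γ' + t * Complex.I) = 0 →
        ∀ (q : ℕ) [NeZero q] (χ : DirichletCharacter ℂ q), χ ≠ 1 → χ ^ 2 = 1 →
          prodChar χ χk ≠ 1 → ∀ d : ℝ, 0 < d → χ.LFunction ((1 - d : ℝ) : ℂ) = 0 →
            c₁ / (((k : ℝ) * ‖(1 - γ' + t * Complex.I : ℂ)‖ * q) ^ (b / 2 * γ') *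
                Real.log ((k : ℝ) * ‖(1 - γ' + t * Complex.I : ℂ)‖ * q) ^ 5) < d)
    (hc₁ : 0 < c₁) {D₁ D₂ : ℕ} [NeZero D₁] [NeZero D₂] (hD : D₁ ≤ D₂)
    {χ₁ : DirichletCharacter ℂ D₁} {χ₂ : DirichletCharacter ℂ D₂} (h₁q : χ₁ ^ 2 = 1)
    (h₁ : χ₁ ≠ 1) (h₂q : χ₂ ^ 2 = 1) (h₂ : χ₂ ≠ 1) (hprod : prodChar χ₂ χ₁ ≠ 1)
    {σ₁ σ₂ : ℝ} (hσ₁ : 1 - γ ≤ σ₁) (hσ₁1 : σ₁ ≤ 1) (hz₁ : χ₁.LFunction (σ₁ : ℂ) = 0)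
    (hσ₂ : 1 - c₁ / (32 * Real.log D₂ ^ 5 * (D₂ : ℝ) ^ (b * γ)) ≤ σ₂)
    (hz₂ : χ₂.LFunction (σ₂ : ℂ) = 0) : False := by
  -- the auxiliary zero `σ₁ = 1 − γ'`
  have hσ₁lt : σ₁ < 1 := by
    by_contra hle
    push Not at hle
    exact DirichletCharacter.LFunction_ne_zero_of_one_le_re χ₁ (Or.inl h₁) (s := σ₁)
      (by simpa using hle) hz₁
  have hσ₂lt : σ₂ < 1 := by
    by_contra hle
    push Not at hle
    exact DirichletCharacter.LFunction_ne_zero_of_one_le_re χ₂ (Or.inl h₂) (s := σ₂)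
      (by simpa using hle) hz₂
  set γ' : ℝ := 1 - σ₁ with hγ'def
  have hγ'0 : 0 < γ' := by simp only [hγ'def]; linarith
  have hγ'γ : γ' ≤ γ := by simp only [hγ'def]; linarith
  have hz₁' : χ₁.LFunction (1 - γ' + (0 : ℝ) * Complex.I) = 0 := by
    have e : (1 - γ' + (0 : ℝ) * Complex.I : ℂ) = (σ₁ : ℂ) := by
      simp only [hγ'def]; push_cast; ring
    rw [e]; exact hz₁
  have hz₂' : χ₂.LFunction ((1 - (1 - σ₂) : ℝ) : ℂ) = 0 := by
    rw [show (1 - (1 - σ₂) : ℝ) = σ₂ by ring]; exact hz₂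
  have h := hT3 D₁ χ₁ h₁ γ' 0 hγ'0 hγ'γ (Or.inl h₁q) hz₁' D₂ χ₂ h₂ h₂q hprod (1 - σ₂)
    (by linarith) hz₂'
  -- `U = D₁ σ₁ D₂ ≤ D₂²`
  have hnorm : ‖(1 - γ' + (0 : ℝ) * Complex.I : ℂ)‖ = σ₁ := by
    have e : (1 - γ' + (0 : ℝ) * Complex.I : ℂ) = (σ₁ : ℂ) := by
      simp only [hγ'def]; push_cast; ring
    rw [e, Complex.norm_real, Real.norm_eq_abs, abs_of_pos (by linarith)]
  rw [hnorm] at h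
  have hD₁3 : 3 ≤ D₁ := three_le_of_ne_one' h₁
  have hD₂3 : 3 ≤ D₂ := hD₁3.trans hD
  have hD₁D₂ : (D₁ : ℝ) ≤ D₂ := by exact_mod_cast hD
  have hD₂0 : (0 : ℝ) < D₂ := by exact_mod_cast (show 0 < D₂ by omega)
  have hσ₁34 : 3 / 4 < σ₁ := by linarith
  obtain ⟨hU675, -, -, hL1⟩ := size_facts hD₁3 hD₂3 hσ₁34
  set U : ℝ := (D₁ : ℝ) * σ₁ * D₂ with hUdef
  have hU1 : 1 ≤ U := by norm_num at hU675; linarith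
  have hU0 : 0 < U := by linarith
  have hγ0 : 0 < γ := lt_of_lt_of_le hγ'0 hγ'γ
  have hUD : U ≤ (D₂ : ℝ) ^ 2 := by
    have h1 : (D₁ : ℝ) * σ₁ ≤ D₂ :=
      calc (D₁ : ℝ) * σ₁ ≤ (D₁ : ℝ) * 1 := mul_le_mul_of_nonneg_left hσ₁1 (by positivity)
        _ ≤ D₂ := by rw [mul_one]; exact hD₁D₂
    calc U = (D₁ : ℝ) * σ₁ * D₂ := hUdef
      _ ≤ (D₂ : ℝ) * D₂ := mul_le_mul_of_nonneg_right h1 hD₂0.le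
      _ = (D₂ : ℝ) ^ 2 := by ring
  have hL0 : 0 < Real.log U := by linarith
  -- `U^{(b/2)γ'} ≤ D₂^{bγ}` and `log⁵U ≤ 32 log⁵D₂`
  have hpow : U ^ (b / 2 * γ') ≤ (D₂ : ℝ) ^ (b * γ) := by
    calc U ^ (b / 2 * γ') ≤ U ^ (b / 2 * γ) :=
          Real.rpow_le_rpow_of_exponent_le hU1 (by nlinarith)
      _ ≤ ((D₂ : ℝ) ^ 2) ^ (b / 2 * γ) := Real.rpow_le_rpow hU0.le hUD (by positivity)
      _ = (D₂ : ℝ) ^ (b * γ) := by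
          rw [show ((D₂ : ℝ) ^ 2) = (D₂ : ℝ) ^ ((2 : ℕ) : ℝ) by rw [Real.rpow_natCast],
            ← Real.rpow_mul hD₂0.le]
          norm_num; ring_nf
  have hlogU : Real.log U ≤ 2 * Real.log D₂ := by
    have := Real.log_le_log hU0 hUD
    rwa [Real.log_pow] at this
  have hlog5 : Real.log U ^ 5 ≤ 32 * Real.log D₂ ^ 5 := by
    have := pow_le_pow_left₀ hL0.le hlogU 5
    nlinarith
  have hden : U ^ (b / 2 * γ') * Real.log U ^ 5 ≤ 32 * Real.log D₂ ^ 5 * (D₂ : ℝ) ^ (b * γ) := by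
    calc U ^ (b / 2 * γ') * Real.log U ^ 5 ≤ (D₂ : ℝ) ^ (b * γ) * (32 * Real.log D₂ ^ 5) :=
          mul_le_mul hpow hlog5 (by positivity) (by positivity)
      _ = 32 * Real.log D₂ ^ 5 * (D₂ : ℝ) ^ (b * γ) := by ring
  have hcmp : c₁ / (32 * Real.log D₂ ^ 5 * (D₂ : ℝ) ^ (b * γ)) ≤
      c₁ / (U ^ (b / 2 * γ') * Real.log U ^ 5) :=
    div_le_div_of_nonneg_left hc₁.le (by positivity) hden
  linarith

end BellottiPuglisi2023

open BellottiPuglisi2023 Pintz1976Heilbronn in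
/-- **Bellotti–Puglisi 2023, Corollary 3 — PROVED in the repaired window `b > 8/(1 − 4γ)`.** For
`0 < γ ≤ 1/8` and `b > 8/(1 − 4γ)` there is `c₁ > 0` such that at most one primitive real character
(equal moduli and equal values) has a real zero in `[1 − min(γ, c₁/(32 log⁵D · D^{bγ})), 1]` — the body
of `bellottiPuglisi2023_corollary3` verbatim with the window replaced. From Theorem 3 at `b/2` (the
character with the smaller modulus supplies the auxiliary zero, `U ≤ D²`; distinct primitive real
characters have a non-principal product, the tree's `Pintz1976Heilbronn.productNonprincipal_of_not_same`).
[cite: BellottiPuglisi2023, Corollary 3 p. 5] -/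
theorem bellottiPuglisi2023_corollary3_largeB :
    ∀ γ b : ℝ, 0 < γ → γ ≤ 1 / 8 → 8 / (1 - 4 * γ) < b → ∃ c₁ : ℝ, 0 < c₁ ∧
      ∀ (D₁ : ℕ) [NeZero D₁] (χ₁ : DirichletCharacter ℂ D₁) (D₂ : ℕ) [NeZero D₂]
        (χ₂ : DirichletCharacter ℂ D₂),
        χ₁.IsQuadratic → χ₁.IsPrimitive → χ₁ ≠ 1 → χ₂.IsQuadratic → χ₂.IsPrimitive → χ₂ ≠ 1 →
        (∃ σ₁ : ℝ, 1 - min γ (c₁ / (32 * Real.log D₁ ^ 5 * (D₁ : ℝ) ^ (b * γ))) ≤ σ₁ ∧ σ₁ ≤ 1 ∧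
            χ₁.LFunction (σ₁ : ℂ) = 0) →
        (∃ σ₂ : ℝ, 1 - min γ (c₁ / (32 * Real.log D₂ ^ 5 * (D₂ : ℝ) ^ (b * γ))) ≤ σ₂ ∧ σ₂ ≤ 1 ∧
            χ₂.LFunction (σ₂ : ℂ) = 0) →
          D₁ = D₂ ∧ ∀ n : ℕ, χ₁ (n : ZMod D₁) = χ₂ (n : ZMod D₂) := by
  intro γ b hγ hγ8 hb
  have hγ4 : γ < 1 / 4 := by linarith
  have h14 : 0 < 1 - 4 * γ := by linarith
  have hb2 : 4 / (1 - 4 * γ) < b / 2 := by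
    rw [div_lt_iff₀ h14] at hb
    rw [div_lt_iff₀ h14]
    linarith
  have hbpos : 0 < b := by
    have := (div_lt_iff₀ h14).mp hb; nlinarith
  obtain ⟨c₁, hc₁, hT3⟩ := theorem3_core hγ hγ4 hb2
  have hT3' : ∀ (k : ℕ) [NeZero k] (χk : DirichletCharacter ℂ k), χk ≠ 1 →
      ∀ γ' t : ℝ, 0 < γ' → γ' ≤ γ → (χk ^ 2 = 1 ∨ γ' ≤ 1 / 8) →
      χk.LFunction (1 - γ' + t * Complex.I) = 0 →
        ∀ (q : ℕ) [NeZero q] (χ : DirichletCharacter ℂ q), χ ≠ 1 → χ ^ 2 = 1 →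
          prodChar χ χk ≠ 1 → ∀ d : ℝ, 0 < d → χ.LFunction ((1 - d : ℝ) : ℂ) = 0 →
            c₁ / (((k : ℝ) * ‖(1 - γ' + t * Complex.I : ℂ)‖ * q) ^ (b / 2 * γ') *
                Real.log ((k : ℝ) * ‖(1 - γ' + t * Complex.I : ℂ)‖ * q) ^ 5) < d := by
    intro k _ χk hχk γ' t h0 hle hcase hz q _ χ hχ hq hψ d hd hzd
    have := hT3 k χk hχk γ' t h0 hle hcase hz q χ hχ hq hψ d hd hzd
    rwa [show b / 2 * γ' = b / 2 * γ' from rfl]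
  refine ⟨c₁, hc₁, ?_⟩
  intro D₁ _ χ₁ D₂ _ χ₂ h₁q h₁p h₁ h₂q h₂p h₂ ⟨σ₁, hσ₁, hσ₁1, hz₁⟩ ⟨σ₂, hσ₂, hσ₂1, hz₂⟩
  by_contra hne
  have hmin₁ : 1 - γ ≤ σ₁ := by
    have := min_le_left γ (c₁ / (32 * Real.log D₁ ^ 5 * (D₁ : ℝ) ^ (b * γ))); linarith
  have hmin₁' : 1 - c₁ / (32 * Real.log D₁ ^ 5 * (D₁ : ℝ) ^ (b * γ)) ≤ σ₁ := by
    have := min_le_right γ (c₁ / (32 * Real.log D₁ ^ 5 * (D₁ : ℝ) ^ (b * γ))); linarith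
  have hmin₂ : 1 - γ ≤ σ₂ := by
    have := min_le_left γ (c₁ / (32 * Real.log D₂ ^ 5 * (D₂ : ℝ) ^ (b * γ))); linarith
  have hmin₂' : 1 - c₁ / (32 * Real.log D₂ ^ 5 * (D₂ : ℝ) ^ (b * γ)) ≤ σ₂ := by
    have := min_le_right γ (c₁ / (32 * Real.log D₂ ^ 5 * (D₂ : ℝ) ^ (b * γ))); linarith
  rcases le_total D₁ D₂ with hD | hD
  · have hprod : ProductNonprincipal χ₁ χ₂ := productNonprincipal_of_not_same h₁p h₂p h₂q hne
    exact corollary3_oneway hγ4 hbpos hT3' hc₁ hD h₁q.sq_eq_one h₁ h₂q.sq_eq_one h₂ hprod hmin₁ hσ₁1 hz₁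
      hmin₂' hz₂
  · have hne' : ¬ (D₂ = D₁ ∧ ∀ n : ℕ, χ₂ (n : ZMod D₂) = χ₁ (n : ZMod D₁)) := by
      rintro ⟨hDD, hval⟩
      exact hne ⟨hDD.symm, fun n => (hval n).symm⟩
    have hprod : ProductNonprincipal χ₂ χ₁ := productNonprincipal_of_not_same h₂p h₁p h₁q hne'
    exact corollary3_oneway hγ4 hbpos hT3' hc₁ hD h₂q.sq_eq_one h₂ h₁q.sq_eq_one h₁ hprod hmin₂ hσ₂1 hz₂
      hmin₁' hz₁


end Literature.NumberTheory.LFunctions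

end
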